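import Literature.NumberTheory.Sieve.BombieriFriedlanderIwaniecTheorem7StarProofs
import HarnessLib

/-!
# Bombieri–Friedlander–Iwaniec 1986, Theorem 7* (§14): the sieve extension `Δ → Δ*`, algebraic part

Topic `Literature/NumberTheory/Sieve`, continuation of
`Literature.NumberTheory.Sieve.BombieriFriedlanderIwaniecTheorem7StarProofs`.  Everything here is
PROVED; no named fact is introduced.

BFI, §14, p. 246: "THEOREM 7. If (14.5) and (14.6) hold, then we have (14.1). As in Section 12,
using Lemma 4 we can extend the result to sums `Δ*(M, N, L, Q, R)` say, where the variables
`l, m, n` are free of prime factors `p < z (≤ z₀)`. This gives THEOREM 7*."  In Section 12 (p. 238)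
the extension of Theorem 5 to Theorem 5* is: sandwich the indicator `1_{(m,P(z))=1}` between the
lower and upper functions of a sieve of Fundamental-Lemma type (Lemma 4), so that the sifted sum is
bounded by weighted sums of UNSIFTED sums at the scales `M/d`, `d` below the level of the sieve,
plus a remainder controlled by the Fundamental Lemma.  For `Δ*` two variables (`m` and `n`) are
sifted (the roughness of `l` is a mere restriction of the outer sum), and this file provides the
algebra of that double extension, for general real weights:

* `BFI.wBracket a M N ωm ωn l d`, `BFI.qSumW`, `BFI.deltaW a M N L Q R ωl ωm ωn` — the bracket of
  §14 at `(l, d)`, its `q`-sum, and the sum `Δ` with real weights `ωl, ωm, ωn` on the three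
  variables (`BFI.deltaStar_eq_deltaW`: `Δ* = deltaW` with the three rough indicators;
  `BFI.deltaW_comm`: symmetry `m ↔ n`; linearity in `ωm`; monotonicity in `ωl`).
* `BFI.qSumW_dvd_indicator` — KEY IDENTITY: a divisibility weight `1_{d ∣ m}` on `m` turns the
  `q`-sum at `l` into the `q`-sum at `l·d` with `m` at scale `M/d` (and kills it unless
  `(d, r) = 1`): the pieces of the sieve are brackets of `Δ` itself, at `(M/d, N, L·d, Q, R)`, with
  the SAME `x = LMN`.
* `BFI.deltaW_le_of_divisorWeight` — EXPANSION: for `ωm = ∑_i c_i 1_{d_i ∣ ·}` and `0 ≤ ωl ≤ T`,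
  `deltaW(M, N, L; ωl, ωm, ωn) ≤ T ∑_i |c_i| deltaW(M/d_i, N, L d_i; 1, 1, ωn)` (reindex `l ↦ l d_i`).
* `BFI.deltaW_rough_le_sandwich` — SANDWICH in the variable `m` (BFI p. 238, "`E⁻ − Δ ≤ E ≤ E⁺ + Δ`",
  through `BFI.abs_sum_sandwich_le` and the two-range weights `TwoRangeSieve.wU/wL` of the tree):
  for `ωl, ωn ≥ 0`,
  `deltaW(ωl, 1_{(·,P(z))=1}, ωn) ≤ 2 deltaW(ωl, U, ωn) + deltaW(ωl, U − L, ωn) + Rem`,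
  `Rem = ∑_{r,l} ωl(l) ∑_q φ(qr)⁻¹ (∑_n ωn(n) 1_{(n,qr)=1}) (∑_m (U − L)(m) 1_{(m,qr)=1})`.
* `BFI.deltaStar_le_deltaW_merge` — merging a short `n` into `l` with divisor-function
  multiplicity: `Δ*(M, N, L, Q, R) ≤ deltaW(M, 1, LN, Q, R; τ·1_rough, 1_rough, 1_rough)`
  (keeps `x = LMN` unchanged, unlike `BFI.deltaStar_le_sum_deltaStar_one`).
* `BFI.sum_sieveU_coprime_le`, `BFI.remainder_le`, `BFI.sum_sum_sigma_sq_div_totient_le` — the mass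
  of the upper sieve function on the integers coprime to `k`, the generic bound for the remainders
  of the sandwich, and `∑_{q ≤ Q, r ≤ R} τ(qr)²/φ(qr) ≪ log¹⁶Q log¹⁶R`.

The choice of the sieve parameters, the Fundamental-Lemma numerics and the assembly of Theorem 7*
from Theorem 7 are not in this file.

## References

* E. Bombieri, J. B. Friedlander, H. Iwaniec, *Primes in arithmetic progressions to large moduli*,
  Acta Math. 156 (1986), 203–251: §2 Lemma 4 p. 211; §12 p. 238; §14 p. 246.
  [BombieriFriedlanderIwaniecActa1986]
-/

open Finset Real
open scoped ArithmeticFunction.sigma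

namespace Literature.NumberTheory.Sieve

namespace BFI

/-! ### `Δ` with real weights on the three variables -/

/-- The bracket of BFI §14 (p. 244) at `(l, d)` with real weights `ωm`, `ωn` on the two smooth
variables: `∑_{m ≤ M} ∑_{n ≤ N} ωm(m) ωn(n) (1_{lmn ≡ a (d)} − 1_{(mn,d)=1}/φ(d))`.
[cite: BombieriFriedlanderIwaniecActa1986, §14 p. 244] -/
noncomputable def wBracket (a : ℤ) (M N : ℝ) (ωm ωn : ℕ → ℝ) (l d : ℕ) : ℝ :=
  ∑ m ∈ Icc 1 ⌊M⌋₊, ∑ n ∈ Icc 1 ⌊N⌋₊, ωm m * ωn n *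
    ((if ((l * m * n : ℕ) : ZMod d) = (a : ZMod d) then (1 : ℝ) else 0) -
      (if (m * n).Coprime d then (1 : ℝ) else 0) / (Nat.totient d : ℝ))

/-- The `q`-sum of the weighted brackets for fixed `r`, `l`:
`∑_{q ≤ Q, (q, al) = 1} wBracket(l, qr)`. [cite: BombieriFriedlanderIwaniecActa1986, §14 p. 244] -/
noncomputable def qSumW (a : ℤ) (M N Q : ℝ) (ωm ωn : ℕ → ℝ) (r l : ℕ) : ℝ :=
  ∑ q ∈ (Icc 1 ⌊Q⌋₊).filter (fun q : ℕ => IsCoprime (q : ℤ) (a * l)), wBracket a M N ωm ωn l (q * r)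

/-- **The sums `Δ` of §14 with real weights**:
`deltaW = ∑_{r ≤ R, (r,a)=1} ∑_{l ≤ L, (l,r)=1} ωl(l) |∑_{q ≤ Q, (q,al)=1} wBracket(l, qr)|`.  With the
three weights equal to the rough indicator this is `Δ*` (`deltaStar_eq_deltaW`), with the three
weights `1` it is `Δ`. [cite: BombieriFriedlanderIwaniecActa1986, §14 p. 244] -/
noncomputable def deltaW (a : ℤ) (M N L Q R : ℝ) (ωl ωm ωn : ℕ → ℝ) : ℝ :=
  ∑ r ∈ (Icc 1 ⌊R⌋₊).filter (fun r : ℕ => IsCoprime (r : ℤ) a),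
    ∑ l ∈ (Icc 1 ⌊L⌋₊).filter (fun l : ℕ => l.Coprime r), ωl l * |qSumW a M N Q ωm ωn r l|

/-- `Δ* = deltaW` with the rough indicators as weights. [folklore] -/
theorem wBracket_rough (a : ℤ) (z M N : ℝ) (l d : ℕ) :
    wBracket a M N (roughIndicator z) (roughIndicator z) l d =
      roughCongrCount a z M N l d - roughCoprimeCount z M N d / (Nat.totient d : ℝ) := by
  unfold wBracket roughCongrCount roughCoprimeCount
  rw [Finset.sum_div, ← Finset.sum_sub_distrib]
  refine Finset.sum_congr rfl fun m _ => ?_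
  rw [Finset.sum_div, ← Finset.sum_sub_distrib]
  refine Finset.sum_congr rfl fun n _ => ?_
  split_ifs <;> ring

/-- `Δ*(M,N,L,Q,R) = deltaW` with `ωl = ωm = ωn = 1_{(·,P(z))=1}`. [folklore] -/
theorem deltaStar_eq_deltaW (a : ℤ) (z M N L Q R : ℝ) :
    deltaStar a z M N L Q R =
      deltaW a M N L Q R (roughIndicator z) (roughIndicator z) (roughIndicator z) := by
  unfold deltaStar deltaW qSumW
  simp only [wBracket_rough]

/-- `wBracket` is symmetric in the two weighted variables. [folklore] -/
theorem wBracket_comm (a : ℤ) (M N : ℝ) (ωm ωn : ℕ → ℝ) (l d : ℕ) :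
    wBracket a M N ωm ωn l d = wBracket a N M ωn ωm l d := by
  unfold wBracket
  rw [Finset.sum_comm]
  refine Finset.sum_congr rfl fun n _ => Finset.sum_congr rfl fun m _ => ?_
  rw [mul_right_comm l m n, mul_comm m n, mul_comm (ωm m) (ωn n)]

/-- `deltaW` is symmetric in `(M, ωm) ↔ (N, ωn)`. [folklore] -/
theorem deltaW_comm (a : ℤ) (M N L Q R : ℝ) (ωl ωm ωn : ℕ → ℝ) :
    deltaW a M N L Q R ωl ωm ωn = deltaW a N M L Q R ωl ωn ωm := by
  unfold deltaW qSumW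
  simp only [wBracket_comm a M N ωm ωn]

/-- `wBracket` is additive in `ωm`. [folklore] -/
theorem wBracket_add_m (a : ℤ) (M N : ℝ) (ω₁ ω₂ ωn : ℕ → ℝ) (l d : ℕ) :
    wBracket a M N (fun m => ω₁ m + ω₂ m) ωn l d = wBracket a M N ω₁ ωn l d + wBracket a M N ω₂ ωn l d := by
  unfold wBracket
  rw [← Finset.sum_add_distrib]
  refine Finset.sum_congr rfl fun m _ => ?_
  rw [← Finset.sum_add_distrib]
  refine Finset.sum_congr rfl fun n _ => ?_
  ring

/-- `wBracket` is homogeneous in `ωm`. [folklore] -/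
theorem wBracket_smul_m (c : ℝ) (a : ℤ) (M N : ℝ) (ωm ωn : ℕ → ℝ) (l d : ℕ) :
    wBracket a M N (fun m => c * ωm m) ωn l d = c * wBracket a M N ωm ωn l d := by
  unfold wBracket
  rw [Finset.mul_sum]
  refine Finset.sum_congr rfl fun m _ => ?_
  rw [Finset.mul_sum]
  refine Finset.sum_congr rfl fun n _ => ?_
  ring

/-- `wBracket` is subtractive in `ωm`. [folklore] -/
theorem wBracket_sub_m (a : ℤ) (M N : ℝ) (ω₁ ω₂ ωn : ℕ → ℝ) (l d : ℕ) :
    wBracket a M N (fun m => ω₁ m - ω₂ m) ωn l d = wBracket a M N ω₁ ωn l d - wBracket a M N ω₂ ωn l d := by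
  unfold wBracket
  rw [← Finset.sum_sub_distrib]
  refine Finset.sum_congr rfl fun m _ => ?_
  rw [← Finset.sum_sub_distrib]
  refine Finset.sum_congr rfl fun n _ => ?_
  ring

/-- `wBracket` for a finite linear combination of weights on `m`. [folklore] -/
theorem wBracket_sum_m {ι : Type*} (J : Finset ι) (c : ι → ℝ) (f : ι → ℕ → ℝ) (a : ℤ) (M N : ℝ)
    (ωn : ℕ → ℝ) (l d : ℕ) :
    wBracket a M N (fun m => ∑ i ∈ J, c i * f i m) ωn l d = ∑ i ∈ J, c i * wBracket a M N (f i) ωn l d := by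
  classical
  induction J using Finset.induction_on with
  | empty =>
      simp only [Finset.sum_empty]
      unfold wBracket
      simp
  | insert i J hi ih =>
      rw [Finset.sum_insert hi, ← ih, ← wBracket_smul_m, ← wBracket_add_m]
      refine congrArg (fun ω => wBracket a M N ω ωn l d) ?_
      funext m
      rw [Finset.sum_insert hi]

/-- `qSumW` for a finite linear combination of weights on `m`. [folklore] -/
theorem qSumW_sum_m {ι : Type*} (J : Finset ι) (c : ι → ℝ) (f : ι → ℕ → ℝ) (a : ℤ) (M N Q : ℝ)
    (ωn : ℕ → ℝ) (r l : ℕ) :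
    qSumW a M N Q (fun m => ∑ i ∈ J, c i * f i m) ωn r l = ∑ i ∈ J, c i * qSumW a M N Q (f i) ωn r l := by
  unfold qSumW
  simp only [wBracket_sum_m, Finset.mul_sum]
  rw [Finset.sum_comm]

/-- `qSumW` is subtractive in `ωm`. [folklore] -/
theorem qSumW_sub_m (a : ℤ) (M N Q : ℝ) (ω₁ ω₂ ωn : ℕ → ℝ) (r l : ℕ) :
    qSumW a M N Q (fun m => ω₁ m - ω₂ m) ωn r l = qSumW a M N Q ω₁ ωn r l - qSumW a M N Q ω₂ ωn r l := by
  unfold qSumW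
  rw [← Finset.sum_sub_distrib]
  exact Finset.sum_congr rfl fun q _ => wBracket_sub_m a M N ω₁ ω₂ ωn l _

/-- `wBracket` depends only on the values of the weights on the ranges. [folklore] -/
theorem wBracket_congr {a : ℤ} {M N : ℝ} {ωm ωm' ωn ωn' : ℕ → ℝ}
    (hm : ∀ m ∈ Icc 1 ⌊M⌋₊, ωm m = ωm' m) (hn : ∀ n ∈ Icc 1 ⌊N⌋₊, ωn n = ωn' n) (l d : ℕ) :
    wBracket a M N ωm ωn l d = wBracket a M N ωm' ωn' l d := by
  unfold wBracket
  refine Finset.sum_congr rfl fun m hm' => Finset.sum_congr rfl fun n hn' => ?_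
  rw [hm m hm', hn n hn']

/-- `deltaW` depends only on the values of the weights on the ranges. [folklore] -/
theorem deltaW_congr {a : ℤ} {M N L Q R : ℝ} {ωl ωm ωm' ωn ωn' : ℕ → ℝ}
    (hm : ∀ m ∈ Icc 1 ⌊M⌋₊, ωm m = ωm' m) (hn : ∀ n ∈ Icc 1 ⌊N⌋₊, ωn n = ωn' n) :
    deltaW a M N L Q R ωl ωm ωn = deltaW a M N L Q R ωl ωm' ωn' := by
  unfold deltaW qSumW
  simp only [wBracket_congr hm hn]

/-- `deltaW ≥ 0` for `ωl ≥ 0`. [folklore] -/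
theorem deltaW_nonneg {ωl : ℕ → ℝ} (hωl : ∀ l, 0 ≤ ωl l) (a : ℤ) (M N L Q R : ℝ) (ωm ωn : ℕ → ℝ) :
    0 ≤ deltaW a M N L Q R ωl ωm ωn :=
  Finset.sum_nonneg fun _ _ => Finset.sum_nonneg fun l _ => mul_nonneg (hωl l) (abs_nonneg _)

/-- `deltaW` is monotone in the (nonnegative) weight `ωl`. [folklore] -/
theorem deltaW_mono_l {ωl ωl' : ℕ → ℝ} (h : ∀ l, ωl l ≤ ωl' l) (a : ℤ) (M N L Q R : ℝ)
    (ωm ωn : ℕ → ℝ) : deltaW a M N L Q R ωl ωm ωn ≤ deltaW a M N L Q R ωl' ωm ωn :=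
  Finset.sum_le_sum fun _ _ => Finset.sum_le_sum fun l _ =>
    mul_le_mul_of_nonneg_right (h l) (abs_nonneg _)

/-- `deltaW` is monotone in `L` for `ωl ≥ 0`. [folklore] -/
theorem deltaW_mono_L {ωl : ℕ → ℝ} (hωl : ∀ l, 0 ≤ ωl l) {L L' : ℝ} (hLL' : L ≤ L') (a : ℤ)
    (M N Q R : ℝ) (ωm ωn : ℕ → ℝ) :
    deltaW a M N L Q R ωl ωm ωn ≤ deltaW a M N L' Q R ωl ωm ωn := by
  unfold deltaW
  refine Finset.sum_le_sum fun r _ => ?_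
  refine Finset.sum_le_sum_of_subset_of_nonneg ?_ fun l _ _ => mul_nonneg (hωl l) (abs_nonneg _)
  exact Finset.filter_subset_filter _ (Finset.Icc_subset_Icc_right (Nat.floor_mono hLL'))

/-- Triangle inequality in `ωm`: `deltaW(ω₁ − ω₂) ≤ deltaW(ω₁) + deltaW(ω₂)` for `ωl ≥ 0`. [folklore] -/
theorem deltaW_sub_m_le {ωl : ℕ → ℝ} (hωl : ∀ l, 0 ≤ ωl l) (a : ℤ) (M N L Q R : ℝ)
    (ω₁ ω₂ ωn : ℕ → ℝ) :
    deltaW a M N L Q R ωl (fun m => ω₁ m - ω₂ m) ωn ≤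
      deltaW a M N L Q R ωl ω₁ ωn + deltaW a M N L Q R ωl ω₂ ωn := by
  unfold deltaW
  rw [← Finset.sum_add_distrib]
  refine Finset.sum_le_sum fun r _ => ?_
  rw [← Finset.sum_add_distrib]
  refine Finset.sum_le_sum fun l _ => ?_
  rw [← mul_add, qSumW_sub_m]
  exact mul_le_mul_of_nonneg_left (abs_sub _ _) (hωl l)

/-! ### The key identity: a divisibility weight on `m` produces a bracket of `Δ` at `(M/d, L·d)` -/

/-- The `q`-ranges: `{q ≤ Q : (q, al) = 1, (q, d) = 1} = {q ≤ Q : (q, a(ld)) = 1}`. [folklore] -/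
theorem filter_isCoprime_mul_eq (a : ℤ) (Q : ℝ) (l d : ℕ) :
    ((Icc 1 ⌊Q⌋₊).filter (fun q : ℕ => IsCoprime (q : ℤ) (a * l))).filter
        (fun q : ℕ => q.Coprime d) =
      (Icc 1 ⌊Q⌋₊).filter (fun q : ℕ => IsCoprime (q : ℤ) (a * ((l * d : ℕ) : ℤ))) := by
  ext q
  simp only [Finset.mem_filter]
  constructor
  · rintro ⟨⟨hq, hqal⟩, hqd⟩
    refine ⟨hq, ?_⟩
    rw [Nat.cast_mul, ← mul_assoc]
    exact IsCoprime.mul_right hqal (Nat.isCoprime_iff_coprime.mpr hqd)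
  · rintro ⟨hq, h⟩
    rw [Nat.cast_mul, ← mul_assoc] at h
    exact ⟨⟨hq, h.of_mul_right_left⟩, Nat.isCoprime_iff_coprime.mp h.of_mul_right_right⟩

/-- The multiples of `d` in `[1, ⌊M⌋]` are the `d m'`, `m' ∈ [1, ⌊M/d⌋]` (`d ≥ 1`). [folklore] -/
theorem sum_Icc_filter_dvd_eq {M : ℝ} (hM : 0 ≤ M) {d : ℕ} (hd : 0 < d) (f : ℕ → ℝ) :
    ∑ m ∈ (Icc 1 ⌊M⌋₊).filter (fun m : ℕ => d ∣ m), f m = ∑ m' ∈ Icc 1 ⌊M / d⌋₊, f (d * m') := by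
  have h := sum_Ioc_filter_dvd_eq_sum_div (le_refl (0 : ℝ)) hM hd f
  rw [zero_div, Nat.floor_zero] at h
  rwa [show Icc 1 ⌊M⌋₊ = Ioc 0 ⌊M⌋₊ from Finset.Icc_succ_left_eq_Ioc 0 _,
    show Icc 1 ⌊M / d⌋₊ = Ioc 0 ⌊M / d⌋₊ from Finset.Icc_succ_left_eq_Ioc 0 _]

/-- **The bracket with the weight `1_{d ∣ m}`.**  For `(k, a) = 1`, `d ≥ 1`, `M ≥ 0`:
`wBracket(M, N; 1_{d∣·}, ωn)(l, k) = 1_{(d,k)=1} · wBracket(M/d, N; 1, ωn)(l d, k)` — substitute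
`m = d m'`; the congruence `l(dm')n ≡ a` is the congruence `(ld)m'n ≡ a`, the coprimality
`(dm'n, k) = 1` is `(d,k) = 1 ∧ (m'n, k) = 1`, and for `(d, k) > 1` the congruence has no solution.
[folklore] -/
theorem wBracket_dvd_indicator {a : ℤ} {M : ℝ} (hM : 0 ≤ M) (N : ℝ) (ωn : ℕ → ℝ) (l : ℕ) {d k : ℕ}
    (hd : 0 < d) (hka : IsCoprime (k : ℤ) a) :
    wBracket a M N (fun m => if d ∣ m then 1 else 0) ωn l k =
      (if d.Coprime k then 1 else 0) * wBracket a (M / d) N (fun _ => 1) ωn (l * d) k := by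
  unfold wBracket
  -- restrict to the multiples of `d` and substitute `m = d m'`
  have h1 : ∑ m ∈ Icc 1 ⌊M⌋₊, ∑ n ∈ Icc 1 ⌊N⌋₊, (if d ∣ m then (1 : ℝ) else 0) * ωn n *
      ((if ((l * m * n : ℕ) : ZMod k) = (a : ZMod k) then (1 : ℝ) else 0) -
        (if (m * n).Coprime k then (1 : ℝ) else 0) / (Nat.totient k : ℝ)) =
      ∑ m ∈ (Icc 1 ⌊M⌋₊).filter (fun m : ℕ => d ∣ m), ∑ n ∈ Icc 1 ⌊N⌋₊, ωn n *
        ((if ((l * m * n : ℕ) : ZMod k) = (a : ZMod k) then (1 : ℝ) else 0) -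
          (if (m * n).Coprime k then (1 : ℝ) else 0) / (Nat.totient k : ℝ)) := by
    rw [Finset.sum_filter]
    refine Finset.sum_congr rfl fun m _ => ?_
    split_ifs with hdm
    · exact Finset.sum_congr rfl fun n _ => by rw [one_mul]
    · rw [Finset.sum_eq_zero fun n _ => by rw [zero_mul, zero_mul]]
  rw [h1, sum_Icc_filter_dvd_eq hM hd]
  by_cases hdk : d.Coprime k
  · rw [if_pos hdk, one_mul]
    refine Finset.sum_congr rfl fun m' _ => Finset.sum_congr rfl fun n _ => ?_
    rw [one_mul]
    congr 2
    · rw [show l * (d * m') * n = l * d * m' * n by ring]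
    · by_cases h : (m' * n).Coprime k
      · rw [if_pos h, if_pos]
        rw [show d * m' * n = d * (m' * n) by ring]
        exact Nat.Coprime.mul_left hdk h
      · rw [if_neg h, if_neg]
        intro h'
        rw [show d * m' * n = d * (m' * n) by ring] at h'
        exact h (Nat.Coprime.coprime_mul_left h')
  · rw [if_neg hdk, zero_mul]
    refine Finset.sum_eq_zero fun m' _ => Finset.sum_eq_zero fun n _ => ?_
    rw [if_neg, if_neg, zero_div, sub_zero, mul_zero]
    · intro h'
      rw [show d * m' * n = d * (m' * n) by ring] at h'
      exact hdk (Nat.Coprime.coprime_mul_right h')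
    · intro h'
      have hc : k.Coprime (l * (d * m') * n) := by
        have h'' : ((l * (d * m') * n * 1 : ℕ) : ZMod k) = (a : ZMod k) := by rwa [mul_one]
        exact coprime_of_natCast_mul_eq hka (m := l * (d * m') * n) (n := 1) h''
      refine hdk (Nat.Coprime.symm ?_)
      rw [show l * (d * m') * n = d * (l * m' * n) by ring] at hc
      exact Nat.Coprime.coprime_mul_right_right hc

/-- **KEY IDENTITY** (the pieces of the sieve are brackets of `Δ`): for `(r, a) = 1`, `d ≥ 1`,
`M ≥ 0`, the `q`-sum with the weight `1_{d∣m}` at `l` is the `q`-sum with the weight `1` at `l d`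
and the scale `M/d` — and vanishes unless `(d, r) = 1`:
`qSumW(M, N, Q; 1_{d∣·}, ωn)(r, l) = 1_{(d,r)=1} qSumW(M/d, N, Q; 1, ωn)(r, l d)`. [folklore] -/
theorem qSumW_dvd_indicator {a : ℤ} {M : ℝ} (hM : 0 ≤ M) (N Q : ℝ) (ωn : ℕ → ℝ) {r : ℕ}
    (hra : IsCoprime (r : ℤ) a) (l : ℕ) {d : ℕ} (hd : 0 < d) :
    qSumW a M N Q (fun m => if d ∣ m then 1 else 0) ωn r l =
      (if d.Coprime r then 1 else 0) * qSumW a (M / d) N Q (fun _ => 1) ωn r (l * d) := by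
  unfold qSumW
  have hterm : ∀ q ∈ (Icc 1 ⌊Q⌋₊).filter (fun q : ℕ => IsCoprime (q : ℤ) (a * l)),
      wBracket a M N (fun m => if d ∣ m then 1 else 0) ωn l (q * r) =
        (if d.Coprime (q * r) then 1 else 0) * wBracket a (M / d) N (fun _ => 1) ωn (l * d) (q * r) := by
    intro q hq
    rw [Finset.mem_filter] at hq
    have hka : IsCoprime ((q * r : ℕ) : ℤ) a := by
      push_cast
      exact IsCoprime.mul_left hq.2.of_mul_right_left hra
    exact wBracket_dvd_indicator hM N ωn l hd hka
  rw [Finset.sum_congr rfl hterm]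
  by_cases hdr : d.Coprime r
  · rw [if_pos hdr, one_mul, ← filter_isCoprime_mul_eq]
    conv_rhs => rw [Finset.sum_filter]
    refine Finset.sum_congr rfl fun q _ => ?_
    by_cases hqd : q.Coprime d
    · rw [if_pos (Nat.Coprime.mul_right hqd.symm hdr), if_pos hqd, one_mul]
    · rw [if_neg (fun h => hqd (Nat.Coprime.coprime_mul_right_right h).symm), if_neg hqd, zero_mul]
  · rw [if_neg hdr, zero_mul]
    refine Finset.sum_eq_zero fun q _ => ?_
    rw [if_neg (fun h => hdr (Nat.Coprime.coprime_mul_left_right h)), zero_mul]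

/-! ### Expansion of a divisor-sum weight on `m` -/

/-- Reindexing `l ↦ l d` (`d ≥ 1`): for `F ≥ 0` and `ωl ≤ T`, `T ≥ 0`,
`∑_{l ≤ L, (l,r)=1} ωl(l) 1_{(d,r)=1} F(l d) ≤ T ∑_{l' ≤ L d, (l',r)=1} F(l')`. [folklore] -/
theorem sum_filter_mul_reindex_le {ωl : ℕ → ℝ} {T : ℝ} (hT : 0 ≤ T) {L : ℝ}
    (hωl1 : ∀ l ∈ Icc 1 ⌊L⌋₊, ωl l ≤ T) {F : ℕ → ℝ} (hF : ∀ l, 0 ≤ F l) (r : ℕ) {d : ℕ} (hd : 0 < d) :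
    ∑ l ∈ (Icc 1 ⌊L⌋₊).filter (fun l : ℕ => l.Coprime r),
        ωl l * ((if d.Coprime r then (1 : ℝ) else 0) * F (l * d)) ≤
      T * ∑ l' ∈ (Icc 1 ⌊L * d⌋₊).filter (fun l' : ℕ => l'.Coprime r), F l' := by
  by_cases hdr : d.Coprime r
  · simp only [if_pos hdr, one_mul]
    have hinj : Set.InjOn (fun l : ℕ => l * d) ((Icc 1 ⌊L⌋₊).filter (fun l : ℕ => l.Coprime r)) :=
      fun l₁ _ l₂ _ h => Nat.eq_of_mul_eq_mul_right hd h
    calc ∑ l ∈ (Icc 1 ⌊L⌋₊).filter (fun l : ℕ => l.Coprime r), ωl l * F (l * d)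
        ≤ ∑ l ∈ (Icc 1 ⌊L⌋₊).filter (fun l : ℕ => l.Coprime r), T * F (l * d) :=
          Finset.sum_le_sum fun l hl =>
            mul_le_mul_of_nonneg_right (hωl1 l (Finset.mem_of_mem_filter l hl)) (hF _)
      _ = T * ∑ l ∈ (Icc 1 ⌊L⌋₊).filter (fun l : ℕ => l.Coprime r), F (l * d) := by
          rw [Finset.mul_sum]
      _ = T * ∑ l' ∈ ((Icc 1 ⌊L⌋₊).filter (fun l : ℕ => l.Coprime r)).image (fun l : ℕ => l * d), F l' := by
          rw [Finset.sum_image hinj]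
      _ ≤ _ := by
          refine mul_le_mul_of_nonneg_left ?_ hT
          refine Finset.sum_le_sum_of_subset_of_nonneg ?_ fun l' _ _ => hF l'
          intro l' hl'
          rw [Finset.mem_image] at hl'
          obtain ⟨l, hl, rfl⟩ := hl'
          rw [Finset.mem_filter, Finset.mem_Icc] at hl ⊢
          have hL1 : (1 : ℝ) ≤ L := Nat.floor_pos.mp (by omega)
          refine ⟨⟨Nat.mul_pos (by omega) hd, Nat.le_floor ?_⟩, Nat.Coprime.mul_left hl.2 hdr⟩
          push_cast
          exact mul_le_mul_of_nonneg_right ((Nat.cast_le.2 hl.1.2).trans (Nat.floor_le (by linarith)))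
            (Nat.cast_nonneg d)
  · simp only [if_neg hdr, zero_mul, mul_zero, Finset.sum_const_zero]
    exact mul_nonneg hT (Finset.sum_nonneg fun l' _ => hF l')

/-- **EXPANSION of a divisor-sum weight on `m`.**  Let `ωm(m) = ∑_{i ∈ J} c_i 1_{d_i ∣ m}` with all
`d_i ≥ 1`, `0 ≤ ωl ≤ T`, `M ≥ 0`.  Then
`deltaW(M, N, L, Q, R; ωl, ωm, ωn) ≤ T ∑_{i ∈ J} |c_i| · deltaW(M/d_i, N, L d_i, Q, R; 1, 1, ωn)`.
(Linearity in `ωm`, the key identity `qSumW_dvd_indicator`, and the reindexing `l ↦ l d_i`.)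
[cite: BombieriFriedlanderIwaniecActa1986, §12 p. 238 ("the inner sum can be interpreted as `E(d⁻¹M, dN; q, a)`")] -/
theorem deltaW_le_of_divisorWeight {ι : Type*} (J : Finset ι) (c : ι → ℝ) {dv : ι → ℕ}
    (hdv : ∀ i ∈ J, 0 < dv i) {ωl : ℕ → ℝ} {T L : ℝ} (hT : 0 ≤ T) (hωl0 : ∀ l, 0 ≤ ωl l)
    (hωl1 : ∀ l ∈ Icc 1 ⌊L⌋₊, ωl l ≤ T) (a : ℤ) {M : ℝ} (hM : 0 ≤ M) (N Q R : ℝ) (ωn : ℕ → ℝ) :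
    deltaW a M N L Q R ωl (fun m => ∑ i ∈ J, c i * (if dv i ∣ m then (1 : ℝ) else 0)) ωn ≤
      T * ∑ i ∈ J, |c i| * deltaW a (M / dv i) N (L * dv i) Q R (fun _ => 1) (fun _ => 1) ωn := by
  conv_lhs => unfold deltaW
  -- per `(r, l)`: linearity and the key identity
  have hrl : ∀ r ∈ (Icc 1 ⌊R⌋₊).filter (fun r : ℕ => IsCoprime (r : ℤ) a),
      ∀ l ∈ (Icc 1 ⌊L⌋₊).filter (fun l : ℕ => l.Coprime r),
        ωl l * |qSumW a M N Q (fun m => ∑ i ∈ J, c i * (if dv i ∣ m then (1 : ℝ) else 0)) ωn r l| ≤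
          ∑ i ∈ J, |c i| * (ωl l * ((if (dv i).Coprime r then (1 : ℝ) else 0) *
            |qSumW a (M / dv i) N Q (fun _ => 1) ωn r (l * dv i)|)) := by
    intro r hr l _
    rw [Finset.mem_filter] at hr
    rw [qSumW_sum_m]
    calc ωl l * |∑ i ∈ J, c i * qSumW a M N Q (fun m => if dv i ∣ m then (1 : ℝ) else 0) ωn r l|
        ≤ ωl l * ∑ i ∈ J, |c i * qSumW a M N Q (fun m => if dv i ∣ m then (1 : ℝ) else 0) ωn r l| :=
          mul_le_mul_of_nonneg_left (Finset.abs_sum_le_sum_abs _ _) (hωl0 l)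
      _ = ∑ i ∈ J, |c i| * (ωl l * ((if (dv i).Coprime r then (1 : ℝ) else 0) *
            |qSumW a (M / dv i) N Q (fun _ => 1) ωn r (l * dv i)|)) := by
          rw [Finset.mul_sum]
          refine Finset.sum_congr rfl fun i hi => ?_
          rw [qSumW_dvd_indicator hM N Q ωn hr.2 l (hdv i hi), abs_mul, abs_mul]
          have : |(if (dv i).Coprime r then (1 : ℝ) else 0)| = (if (dv i).Coprime r then (1 : ℝ) else 0) := by
            split_ifs <;> simp
          rw [this]
          ring
  calc _ ≤ ∑ r ∈ (Icc 1 ⌊R⌋₊).filter (fun r : ℕ => IsCoprime (r : ℤ) a),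
          ∑ l ∈ (Icc 1 ⌊L⌋₊).filter (fun l : ℕ => l.Coprime r),
            ∑ i ∈ J, |c i| * (ωl l * ((if (dv i).Coprime r then (1 : ℝ) else 0) *
              |qSumW a (M / dv i) N Q (fun _ => 1) ωn r (l * dv i)|)) :=
        Finset.sum_le_sum fun r hr => Finset.sum_le_sum fun l hl => hrl r hr l hl
    _ = ∑ r ∈ (Icc 1 ⌊R⌋₊).filter (fun r : ℕ => IsCoprime (r : ℤ) a), ∑ i ∈ J,
          ∑ l ∈ (Icc 1 ⌊L⌋₊).filter (fun l : ℕ => l.Coprime r),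
            |c i| * (ωl l * ((if (dv i).Coprime r then (1 : ℝ) else 0) *
              |qSumW a (M / dv i) N Q (fun _ => 1) ωn r (l * dv i)|)) :=
        Finset.sum_congr rfl fun r _ => Finset.sum_comm
    _ = ∑ i ∈ J, ∑ r ∈ (Icc 1 ⌊R⌋₊).filter (fun r : ℕ => IsCoprime (r : ℤ) a),
          ∑ l ∈ (Icc 1 ⌊L⌋₊).filter (fun l : ℕ => l.Coprime r),
            |c i| * (ωl l * ((if (dv i).Coprime r then (1 : ℝ) else 0) *
              |qSumW a (M / dv i) N Q (fun _ => 1) ωn r (l * dv i)|)) := Finset.sum_comm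
    _ ≤ ∑ i ∈ J, |c i| * (T * deltaW a (M / dv i) N (L * dv i) Q R (fun _ => 1) (fun _ => 1) ωn) := by
        refine Finset.sum_le_sum fun i hi => ?_
        simp only [← Finset.mul_sum]
        refine mul_le_mul_of_nonneg_left ?_ (abs_nonneg _)
        unfold deltaW
        rw [Finset.mul_sum]
        refine Finset.sum_le_sum fun r _ => ?_
        simp only [one_mul]
        exact sum_filter_mul_reindex_le hT hωl1 (fun _ => abs_nonneg _) r (hdv i hi)
    _ = T * ∑ i ∈ J, |c i| * deltaW a (M / dv i) N (L * dv i) Q R (fun _ => 1) (fun _ => 1) ωn := by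
        rw [Finset.mul_sum]
        exact Finset.sum_congr rfl fun i _ => by ring

/-! ### The sandwich in the variable `m` -/

/-- The congruence part of the `q`-sum at `m`: `F_A(m) = ∑_{q} ∑_n ωn(n) 1_{lmn ≡ a (qr)}` (`≥ 0` for
`ωn ≥ 0`). [folklore] -/
noncomputable def congrPartM (a : ℤ) (N Q : ℝ) (ωn : ℕ → ℝ) (r l m : ℕ) : ℝ :=
  ∑ q ∈ (Icc 1 ⌊Q⌋₊).filter (fun q : ℕ => IsCoprime (q : ℤ) (a * l)),
    ∑ n ∈ Icc 1 ⌊N⌋₊, ωn n * (if ((l * m * n : ℕ) : ZMod (q * r)) = (a : ZMod (q * r)) then (1 : ℝ) else 0)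

/-- The coprimality part of the `q`-sum at `m`: `F_B(m) = ∑_{q} ∑_n ωn(n) 1_{(mn,qr)=1}/φ(qr)`. [folklore] -/
noncomputable def coprPartM (a : ℤ) (N Q : ℝ) (ωn : ℕ → ℝ) (r l m : ℕ) : ℝ :=
  ∑ q ∈ (Icc 1 ⌊Q⌋₊).filter (fun q : ℕ => IsCoprime (q : ℤ) (a * l)),
    ∑ n ∈ Icc 1 ⌊N⌋₊, ωn n * (if (m * n).Coprime (q * r) then (1 : ℝ) else 0) / (Nat.totient (q * r) : ℝ)

/-- `F_A ≥ 0` for `ωn ≥ 0` on the range. [folklore] -/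
theorem congrPartM_nonneg {ωn : ℕ → ℝ} {N : ℝ} (hωn : ∀ n ∈ Icc 1 ⌊N⌋₊, 0 ≤ ωn n) (a : ℤ) (Q : ℝ)
    (r l m : ℕ) : 0 ≤ congrPartM a N Q ωn r l m :=
  Finset.sum_nonneg fun _ _ => Finset.sum_nonneg fun n hn =>
    mul_nonneg (hωn n hn) (by split_ifs <;> norm_num)

/-- `F_B ≥ 0` for `ωn ≥ 0` on the range. [folklore] -/
theorem coprPartM_nonneg {ωn : ℕ → ℝ} {N : ℝ} (hωn : ∀ n ∈ Icc 1 ⌊N⌋₊, 0 ≤ ωn n) (a : ℤ) (Q : ℝ)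
    (r l m : ℕ) : 0 ≤ coprPartM a N Q ωn r l m :=
  Finset.sum_nonneg fun _ _ => Finset.sum_nonneg fun n hn =>
    div_nonneg (mul_nonneg (hωn n hn) (by split_ifs <;> norm_num)) (Nat.cast_nonneg _)

/-- The `q`-sum as a single sum over `m`: `qSumW(ωm, ωn)(r, l) = ∑_m ωm(m) (F_A(m) − F_B(m))`. [folklore] -/
theorem qSumW_eq_sum_m (a : ℤ) (M N Q : ℝ) (ωm ωn : ℕ → ℝ) (r l : ℕ) :
    qSumW a M N Q ωm ωn r l =
      ∑ m ∈ Icc 1 ⌊M⌋₊, ωm m * (congrPartM a N Q ωn r l m - coprPartM a N Q ωn r l m) := by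
  unfold qSumW wBracket congrPartM coprPartM
  rw [Finset.sum_comm]
  refine Finset.sum_congr rfl fun m _ => ?_
  rw [← Finset.sum_sub_distrib, Finset.mul_sum]
  refine Finset.sum_congr rfl fun q _ => ?_
  rw [← Finset.sum_sub_distrib, Finset.mul_sum]
  refine Finset.sum_congr rfl fun n _ => ?_
  ring

/-- The remainder factorises over the coprimality conditions:
`∑_m W(m) F_B(m) = ∑_q φ(qr)⁻¹ (∑_n ωn(n) 1_{(n,qr)=1}) (∑_m W(m) 1_{(m,qr)=1})`. [folklore] -/
theorem sum_mul_coprPartM_eq (a : ℤ) (M N Q : ℝ) (W ωn : ℕ → ℝ) (r l : ℕ) :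
    ∑ m ∈ Icc 1 ⌊M⌋₊, W m * coprPartM a N Q ωn r l m =
      ∑ q ∈ (Icc 1 ⌊Q⌋₊).filter (fun q : ℕ => IsCoprime (q : ℤ) (a * l)),
        ((Nat.totient (q * r) : ℝ))⁻¹ *
          ((∑ n ∈ Icc 1 ⌊N⌋₊, ωn n * (if n.Coprime (q * r) then (1 : ℝ) else 0)) *
            (∑ m ∈ Icc 1 ⌊M⌋₊, W m * (if m.Coprime (q * r) then (1 : ℝ) else 0))) := by
  unfold coprPartM
  simp only [Finset.mul_sum]
  rw [Finset.sum_comm]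
  refine Finset.sum_congr rfl fun q _ => Finset.sum_congr rfl fun m _ => ?_
  rw [Finset.sum_mul, Finset.mul_sum]
  refine Finset.sum_congr rfl fun n _ => ?_
  by_cases hm : m.Coprime (q * r) <;> by_cases hn : n.Coprime (q * r)
  · rw [if_pos (Nat.Coprime.mul_left hm hn), if_pos hm, if_pos hn]; ring
  · rw [if_neg (fun h => hn (Nat.Coprime.coprime_mul_left h)), if_pos hm, if_neg hn]; ring
  · rw [if_neg (fun h => hm (Nat.Coprime.coprime_mul_right h)), if_neg hm, if_pos hn]; ring
  · rw [if_neg (fun h => hm (Nat.Coprime.coprime_mul_right h)), if_neg hm, if_neg hn]; ring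

/-- The upper and lower two-range sieve functions on `m` (beta-sieve of level `D₁` below `z₁`,
Brun's pure sieve of depth `2r+1`, resp. `2r`, on `[z₁, z)`):
`U(m) = ∑_i w⁺_i 1_{d(i)∣m}`, `L(m) = ∑_i w⁻_i 1_{d(i)∣m}`. [folklore] -/
noncomputable def sieveU (z₁ z D₁ : ℝ) (r : ℕ) (m : ℕ) : ℝ :=
  ∑ i ∈ TwoRangeSieve.idx z₁ z, TwoRangeSieve.wU D₁ r i * (if TwoRangeSieve.modOf i ∣ m then (1 : ℝ) else 0)

/-- See `sieveU`. [folklore] -/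
noncomputable def sieveL (z₁ z D₁ : ℝ) (r : ℕ) (m : ℕ) : ℝ :=
  ∑ i ∈ TwoRangeSieve.idx z₁ z, TwoRangeSieve.wL D₁ r i * (if TwoRangeSieve.modOf i ∣ m then (1 : ℝ) else 0)

/-- `L(m) ≤ 1_{(m,P(z))=1} ≤ U(m)` for `m ≥ 1` (the two-range sandwich of the tree). [folklore] -/
theorem sieveL_le_rough_le_sieveU {z₁ z : ℝ} (hz : z₁ ≤ z) (D₁ : ℝ) (r : ℕ) {m : ℕ} (hm : m ≠ 0) :
    sieveL z₁ z D₁ r m ≤ roughIndicator z m ∧ roughIndicator z m ≤ sieveU z₁ z D₁ r m := by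
  rw [roughIndicator_eq_coprime_ite z hm]
  exact TwoRangeSieve.sandwich hz D₁ r hm

/-- `U − L ≥ 0` on `m ≥ 1`. [folklore] -/
theorem sieveU_sub_sieveL_nonneg {z₁ z : ℝ} (hz : z₁ ≤ z) (D₁ : ℝ) (r : ℕ) {m : ℕ} (hm : m ≠ 0) :
    0 ≤ sieveU z₁ z D₁ r m - sieveL z₁ z D₁ r m := by
  have h := sieveL_le_rough_le_sieveU hz D₁ r hm
  linarith [h.1, h.2]

/-- `U ≥ 0` on `m ≥ 1`. [folklore] -/
theorem sieveU_nonneg {z₁ z : ℝ} (hz : z₁ ≤ z) (D₁ : ℝ) (r : ℕ) {m : ℕ} (hm : m ≠ 0) :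
    0 ≤ sieveU z₁ z D₁ r m :=
  (roughIndicator_nonneg z m).trans (sieveL_le_rough_le_sieveU hz D₁ r hm).2

/-- **SANDWICH in the variable `m`** (BFI §12 p. 238, "`E⁻ − Δ ≤ E ≤ E⁺ + Δ`", for the sums of
§14): for `z₁ ≤ z`, `ωl ≥ 0`, `ωn ≥ 0`,
`deltaW(ωl, 1_{(·,P(z))=1}, ωn) ≤ 2 deltaW(ωl, U, ωn) + deltaW(ωl, U − L, ωn) + Rem`, where
`Rem = ∑_{r,l} ωl(l) ∑_{q} φ(qr)⁻¹ (∑_n ωn(n)1_{(n,qr)=1}) (∑_m (U−L)(m) 1_{(m,qr)=1})`.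
The three `deltaW` on the right carry the real weights `U`, `U − L` on `m` (to be expanded by
`deltaW_le_of_divisorWeight`), `L = U − (U − L)` having been split so that all `m`-weights met
later are nonnegative. [cite: BombieriFriedlanderIwaniecActa1986, §12 p. 238; §14 p. 246] -/
theorem deltaW_rough_le_sandwich {z₁ z : ℝ} (hz : z₁ ≤ z) (D₁ : ℝ) (rr : ℕ) {ωl ωn : ℕ → ℝ} {N : ℝ}
    (hωl : ∀ l, 0 ≤ ωl l) (hωn : ∀ n ∈ Icc 1 ⌊N⌋₊, 0 ≤ ωn n) (a : ℤ) (M L Q R : ℝ) :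
    deltaW a M N L Q R ωl (roughIndicator z) ωn ≤
      2 * deltaW a M N L Q R ωl (sieveU z₁ z D₁ rr) ωn +
      deltaW a M N L Q R ωl (fun m => sieveU z₁ z D₁ rr m - sieveL z₁ z D₁ rr m) ωn +
      ∑ r ∈ (Icc 1 ⌊R⌋₊).filter (fun r : ℕ => IsCoprime (r : ℤ) a),
        ∑ l ∈ (Icc 1 ⌊L⌋₊).filter (fun l : ℕ => l.Coprime r), ωl l *
          ∑ q ∈ (Icc 1 ⌊Q⌋₊).filter (fun q : ℕ => IsCoprime (q : ℤ) (a * l)),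
            ((Nat.totient (q * r) : ℝ))⁻¹ *
              ((∑ n ∈ Icc 1 ⌊N⌋₊, ωn n * (if n.Coprime (q * r) then (1 : ℝ) else 0)) *
                (∑ m ∈ Icc 1 ⌊M⌋₊, (sieveU z₁ z D₁ rr m - sieveL z₁ z D₁ rr m) *
                  (if m.Coprime (q * r) then (1 : ℝ) else 0))) := by
  set U : ℕ → ℝ := sieveU z₁ z D₁ rr with hU
  set Lw : ℕ → ℝ := sieveL z₁ z D₁ rr with hLw
  unfold deltaW
  rw [Finset.mul_sum, ← Finset.sum_add_distrib, ← Finset.sum_add_distrib]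
  refine Finset.sum_le_sum fun r _ => ?_
  rw [Finset.mul_sum, ← Finset.sum_add_distrib, ← Finset.sum_add_distrib]
  refine Finset.sum_le_sum fun l _ => ?_
  -- per `(r, l)`
  have hsand := abs_sum_sandwich_le (Icc 1 ⌊M⌋₊) (ρ := roughIndicator z) (U := U) (Lw := Lw)
    (FA := congrPartM a N Q ωn r l) (FB := coprPartM a N Q ωn r l)
    (fun m hm => by
      rw [Finset.mem_Icc] at hm
      exact (sieveL_le_rough_le_sieveU hz D₁ rr (by omega)).1)
    (fun m hm => by
      rw [Finset.mem_Icc] at hm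
      exact (sieveL_le_rough_le_sieveU hz D₁ rr (by omega)).2)
    (fun m _ => congrPartM_nonneg hωn a Q r l m) (fun m _ => coprPartM_nonneg hωn a Q r l m)
  rw [← qSumW_eq_sum_m, ← qSumW_eq_sum_m, ← qSumW_eq_sum_m] at hsand
  -- `L = U − (U − L)`
  have hLsplit : qSumW a M N Q Lw ωn r l =
      qSumW a M N Q U ωn r l - qSumW a M N Q (fun m => U m - Lw m) ωn r l := by
    rw [qSumW_sub_m]; ring
  have hLabs : |qSumW a M N Q Lw ωn r l| ≤
      |qSumW a M N Q U ωn r l| + |qSumW a M N Q (fun m => U m - Lw m) ωn r l| := by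
    rw [hLsplit]; exact abs_sub _ _
  -- the remainder
  have hrem : ∑ m ∈ Icc 1 ⌊M⌋₊, (U m - Lw m) * coprPartM a N Q ωn r l m =
      ∑ q ∈ (Icc 1 ⌊Q⌋₊).filter (fun q : ℕ => IsCoprime (q : ℤ) (a * l)),
        ((Nat.totient (q * r) : ℝ))⁻¹ *
          ((∑ n ∈ Icc 1 ⌊N⌋₊, ωn n * (if n.Coprime (q * r) then (1 : ℝ) else 0)) *
            (∑ m ∈ Icc 1 ⌊M⌋₊, (U m - Lw m) * (if m.Coprime (q * r) then (1 : ℝ) else 0))) :=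
    sum_mul_coprPartM_eq a M N Q (fun m => U m - Lw m) ωn r l
  rw [← hrem]
  have hA : |qSumW a M N Q (roughIndicator z) ωn r l| ≤
      2 * |qSumW a M N Q U ωn r l| + |qSumW a M N Q (fun m => U m - Lw m) ωn r l| +
        ∑ m ∈ Icc 1 ⌊M⌋₊, (U m - Lw m) * coprPartM a N Q ωn r l m := by linarith [hsand, hLabs]
  calc ωl l * |qSumW a M N Q (roughIndicator z) ωn r l|
      ≤ ωl l * (2 * |qSumW a M N Q U ωn r l| + |qSumW a M N Q (fun m => U m - Lw m) ωn r l| +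
          ∑ m ∈ Icc 1 ⌊M⌋₊, (U m - Lw m) * coprPartM a N Q ωn r l m) :=
        mul_le_mul_of_nonneg_left hA (hωl l)
    _ = _ := by ring

/-! ### Merging a short `n` into `l`, with divisor-function multiplicity -/

/-- **Merging `n` into `l` at the same `x`, with divisor-function multiplicity**:
`Δ*(M, N, L, Q, R) ≤ deltaW(M, 1, L·N, Q, R; τ·1_rough, 1_rough, 1_rough)`: the pairs `(l, n)` with
`ln = l'` number at most `τ(l')`, the bracket at `(l, n; qr)` is the `N = 1` bracket at `l' = ln`
whenever `(n, qr) = 1` and vanishes otherwise, and `(l', r) = 1`, `(q, a l') = 1` are exactly the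
side conditions of `Δ*` at `l'`.  (This keeps `x = L·N·M` and the level `QR` unchanged, unlike
`BFI.deltaStar_le_sum_deltaStar_one`; the weight `τ(l')` is summed, not maximised, in the sieve
remainder.) [cite: BombieriFriedlanderIwaniecActa1986, §14 p. 246] -/
theorem deltaStar_le_deltaW_merge (a : ℤ) (z M N L Q R : ℝ) :
    deltaStar a z M N L Q R ≤ deltaW a M 1 (L * N) Q R
      (fun l' => (σ 0 l' : ℝ) * roughIndicator z l') (roughIndicator z) (roughIndicator z) := by
  classical
  -- the `N = 1` pieces `F r l' = 1_rough(l') |∑_q bracket(M, 1; l', qr)|`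
  obtain ⟨F, hF⟩ : ∃ F : ℕ → ℕ → ℝ, ∀ r l', F r l' = roughIndicator z l' *
      |∑ q ∈ (Icc 1 ⌊Q⌋₊).filter (fun q : ℕ => IsCoprime (q : ℤ) (a * l')),
        (roughCongrCount a z M 1 l' (q * r) -
          roughCoprimeCount z M 1 (q * r) / (Nat.totient (q * r) : ℝ))| := ⟨_, fun _ _ => rfl⟩
  have hF0 : ∀ r l', 0 ≤ F r l' := fun r l' => by
    rw [hF]; exact mul_nonneg (roughIndicator_nonneg z l') (abs_nonneg _)
  have hrn : ∀ n, 0 ≤ roughIndicator z n := roughIndicator_nonneg z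
  -- Step 1: the bound per `(r, l)` through the decomposition over `n` (as in the companion file)
  have hkey : ∀ r ∈ (Icc 1 ⌊R⌋₊).filter (fun r : ℕ => IsCoprime (r : ℤ) a),
      ∀ l ∈ (Icc 1 ⌊L⌋₊).filter (fun l : ℕ => l.Coprime r),
        roughIndicator z l *
          |∑ q ∈ (Icc 1 ⌊Q⌋₊).filter (fun q : ℕ => IsCoprime (q : ℤ) (a * l)),
            (roughCongrCount a z M N l (q * r) -
              roughCoprimeCount z M N (q * r) / (Nat.totient (q * r) : ℝ))| ≤
        ∑ n ∈ Icc 1 ⌊N⌋₊, (if n.Coprime r then F r (l * n) else 0) := by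
    intro r hr l hl
    have hr' := hr; have hl' := hl
    rw [Finset.mem_filter, Finset.mem_Icc] at hr' hl'
    have hl0 : l ≠ 0 := by omega
    -- rewrite every bracket through `roughBracket_eq_sum_n` and swap the sums
    have h1 : ∑ q ∈ (Icc 1 ⌊Q⌋₊).filter (fun q : ℕ => IsCoprime (q : ℤ) (a * l)),
        (roughCongrCount a z M N l (q * r) -
          roughCoprimeCount z M N (q * r) / (Nat.totient (q * r) : ℝ)) =
        ∑ n ∈ Icc 1 ⌊N⌋₊, roughIndicator z n *
          ∑ q ∈ (Icc 1 ⌊Q⌋₊).filter (fun q : ℕ => IsCoprime (q : ℤ) (a * l)),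
            (if n.Coprime (q * r) then
              roughCongrCount a z M 1 (l * n) (q * r) -
                roughCoprimeCount z M 1 (q * r) / (Nat.totient (q * r) : ℝ)
            else 0) := by
      have : ∀ q ∈ (Icc 1 ⌊Q⌋₊).filter (fun q : ℕ => IsCoprime (q : ℤ) (a * l)),
          roughCongrCount a z M N l (q * r) -
            roughCoprimeCount z M N (q * r) / (Nat.totient (q * r) : ℝ) =
          ∑ n ∈ Icc 1 ⌊N⌋₊, roughIndicator z n *
            (if n.Coprime (q * r) then
              roughCongrCount a z M 1 (l * n) (q * r) -
                roughCoprimeCount z M 1 (q * r) / (Nat.totient (q * r) : ℝ)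
            else 0) := by
        intro q hq
        rw [Finset.mem_filter, Finset.mem_Icc] at hq
        have hda : IsCoprime ((q * r : ℕ) : ℤ) a := by
          push_cast
          exact IsCoprime.mul_left hq.2.of_mul_right_left hr'.2
        exact roughBracket_eq_sum_n a z M N l hda
      rw [Finset.sum_congr rfl this, Finset.sum_comm]
      refine Finset.sum_congr rfl fun n _ => ?_
      rw [Finset.mul_sum]
    rw [h1]
    calc roughIndicator z l * |∑ n ∈ Icc 1 ⌊N⌋₊, roughIndicator z n *
            ∑ q ∈ (Icc 1 ⌊Q⌋₊).filter (fun q : ℕ => IsCoprime (q : ℤ) (a * l)),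
              (if n.Coprime (q * r) then
                roughCongrCount a z M 1 (l * n) (q * r) -
                  roughCoprimeCount z M 1 (q * r) / (Nat.totient (q * r) : ℝ)
              else 0)|
        ≤ roughIndicator z l * ∑ n ∈ Icc 1 ⌊N⌋₊, |roughIndicator z n *
            ∑ q ∈ (Icc 1 ⌊Q⌋₊).filter (fun q : ℕ => IsCoprime (q : ℤ) (a * l)),
              (if n.Coprime (q * r) then
                roughCongrCount a z M 1 (l * n) (q * r) -
                  roughCoprimeCount z M 1 (q * r) / (Nat.totient (q * r) : ℝ)
              else 0)| :=
          mul_le_mul_of_nonneg_left (Finset.abs_sum_le_sum_abs _ _) (hrn l)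
      _ = ∑ n ∈ Icc 1 ⌊N⌋₊, roughIndicator z l * |roughIndicator z n *
            ∑ q ∈ (Icc 1 ⌊Q⌋₊).filter (fun q : ℕ => IsCoprime (q : ℤ) (a * l)),
              (if n.Coprime (q * r) then
                roughCongrCount a z M 1 (l * n) (q * r) -
                  roughCoprimeCount z M 1 (q * r) / (Nat.totient (q * r) : ℝ)
              else 0)| := Finset.mul_sum _ _ _
      _ ≤ _ := Finset.sum_le_sum fun n hn => ?_
    rw [Finset.mem_Icc] at hn
    have hn0 : n ≠ 0 := by omega
    rw [abs_mul, abs_of_nonneg (hrn n)]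
    by_cases hnr : n.Coprime r
    · rw [if_pos hnr, hF, roughIndicator_mul hl0 hn0]
      -- the `q`-sets agree
      have hq : ∑ q ∈ (Icc 1 ⌊Q⌋₊).filter (fun q : ℕ => IsCoprime (q : ℤ) (a * l)),
          (if n.Coprime (q * r) then
            roughCongrCount a z M 1 (l * n) (q * r) -
              roughCoprimeCount z M 1 (q * r) / (Nat.totient (q * r) : ℝ)
          else 0) =
          ∑ q ∈ (Icc 1 ⌊Q⌋₊).filter (fun q : ℕ => IsCoprime (q : ℤ) (a * ((l * n : ℕ) : ℤ))),
            (roughCongrCount a z M 1 (l * n) (q * r) -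
              roughCoprimeCount z M 1 (q * r) / (Nat.totient (q * r) : ℝ)) := by
        rw [← filter_isCoprime_mul_eq]
        conv_rhs => rw [Finset.sum_filter]
        refine Finset.sum_congr rfl fun q _ => ?_
        by_cases hqn : q.Coprime n
        · rw [if_pos (Nat.Coprime.mul_right hqn.symm hnr), if_pos hqn]
        · rw [if_neg (fun h => hqn (Nat.Coprime.coprime_mul_right_right h).symm), if_neg hqn]
      rw [hq, mul_assoc]
    · rw [if_neg hnr]
      refine le_of_eq ?_
      rw [Finset.sum_eq_zero fun q _ => ?_, abs_zero, mul_zero, mul_zero]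
      rw [if_neg (fun h => hnr (Nat.Coprime.coprime_mul_left_right h))]
  -- Step 2: for fixed `r`, collect the pairs `(l, n)` along `l' = l n`
  have hfib : ∀ r ∈ (Icc 1 ⌊R⌋₊).filter (fun r : ℕ => IsCoprime (r : ℤ) a),
      ∑ l ∈ (Icc 1 ⌊L⌋₊).filter (fun l : ℕ => l.Coprime r),
        ∑ n ∈ Icc 1 ⌊N⌋₊, (if n.Coprime r then F r (l * n) else 0) ≤
      ∑ l' ∈ (Icc 1 ⌊L * N⌋₊).filter (fun l' : ℕ => l'.Coprime r), (σ 0 l' : ℝ) * F r l' := by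
    intro r _
    -- the set of admissible pairs and the product map
    set P : Finset (ℕ × ℕ) := ((Icc 1 ⌊L⌋₊).filter (fun l : ℕ => l.Coprime r)) ×ˢ
      ((Icc 1 ⌊N⌋₊).filter (fun n : ℕ => n.Coprime r)) with hP
    have hsumP : ∑ l ∈ (Icc 1 ⌊L⌋₊).filter (fun l : ℕ => l.Coprime r),
        ∑ n ∈ Icc 1 ⌊N⌋₊, (if n.Coprime r then F r (l * n) else 0) =
        ∑ p ∈ P, F r (p.1 * p.2) := by
      rw [hP, Finset.sum_product]
      refine Finset.sum_congr rfl fun l _ => ?_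
      rw [Finset.sum_filter]
    rw [hsumP, Finset.sum_comp (fun l' => F r l') (fun p : ℕ × ℕ => p.1 * p.2)]
    -- each fibre has at most `τ(l')` elements
    have hTl' : ∀ l' ∈ P.image (fun p : ℕ × ℕ => p.1 * p.2),
        ((P.filter (fun p : ℕ × ℕ => p.1 * p.2 = l')).card : ℝ) ≤ (σ 0 l' : ℝ) := by
      intro l' hl'
      rw [Finset.mem_image] at hl'
      obtain ⟨⟨l, n⟩, hp, rfl⟩ := hl'
      rw [hP, Finset.mem_product, Finset.mem_filter, Finset.mem_filter, Finset.mem_Icc,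
        Finset.mem_Icc] at hp
      have hl0 : l ≠ 0 := by omega
      have hn0 : n ≠ 0 := by omega
      have hln0 : l * n ≠ 0 := mul_ne_zero hl0 hn0
      -- the fibre injects into the divisors of `l n`
      have hcard : (P.filter (fun p : ℕ × ℕ => p.1 * p.2 = l * n)).card ≤ (l * n).divisors.card := by
        refine Finset.card_le_card_of_injOn (fun p => p.1) (fun p hp' => ?_) ?_
        · rw [Finset.coe_filter] at hp'
          rw [Finset.mem_coe, Nat.mem_divisors]
          exact ⟨⟨p.2, hp'.2.symm⟩, hln0⟩
        · intro p₁ hp₁ p₂ hp₂ h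
          rw [Finset.coe_filter] at hp₁ hp₂
          have h' : p₁.1 = p₂.1 := h
          have h1 : p₁.1 ≠ 0 := by
            intro h0; apply hln0; rw [← hp₁.2, h0, zero_mul]
          ext
          · exact h'
          · apply Nat.eq_of_mul_eq_mul_left (Nat.pos_of_ne_zero h1)
            rw [hp₁.2, h']
            exact hp₂.2.symm
      calc ((P.filter (fun p : ℕ × ℕ => p.1 * p.2 = l * n)).card : ℝ)
          ≤ ((l * n).divisors.card : ℝ) := by exact_mod_cast hcard
        _ = (σ 0 (l * n) : ℝ) := by rw [ArithmeticFunction.sigma_zero_apply]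
    calc ∑ l' ∈ P.image (fun p : ℕ × ℕ => p.1 * p.2),
          (P.filter (fun p : ℕ × ℕ => p.1 * p.2 = l')).card • F r l'
        ≤ ∑ l' ∈ P.image (fun p : ℕ × ℕ => p.1 * p.2), (σ 0 l' : ℝ) * F r l' := by
          refine Finset.sum_le_sum fun l' hl' => ?_
          rw [nsmul_eq_mul]
          exact mul_le_mul_of_nonneg_right (hTl' l' hl') (hF0 r l')
      _ ≤ ∑ l' ∈ (Icc 1 ⌊L * N⌋₊).filter (fun l' : ℕ => l'.Coprime r), (σ 0 l' : ℝ) * F r l' := by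
          refine Finset.sum_le_sum_of_subset_of_nonneg ?_ fun l' _ _ =>
            mul_nonneg (Nat.cast_nonneg _) (hF0 r l')
          intro l' hl'
          rw [Finset.mem_image] at hl'
          obtain ⟨⟨l, n⟩, hp, rfl⟩ := hl'
          rw [hP, Finset.mem_product, Finset.mem_filter, Finset.mem_filter, Finset.mem_Icc,
            Finset.mem_Icc] at hp
          rw [Finset.mem_filter, Finset.mem_Icc]
          have hL0 : (1 : ℝ) ≤ L := Nat.floor_pos.mp (by omega)
          have hN0 : (1 : ℝ) ≤ N := Nat.floor_pos.mp (by omega)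
          refine ⟨⟨Nat.one_le_iff_ne_zero.2 (mul_ne_zero (by omega) (by omega)), Nat.le_floor ?_⟩,
            Nat.Coprime.mul_left hp.1.2 hp.2.2⟩
          push_cast
          exact mul_le_mul ((Nat.cast_le.2 hp.1.1.2).trans (Nat.floor_le (by linarith)))
            ((Nat.cast_le.2 hp.2.1.2).trans (Nat.floor_le (by linarith))) (Nat.cast_nonneg _)
            (by linarith)
  -- assemble
  have hΔ1 : deltaW a M 1 (L * N) Q R (fun l' => (σ 0 l' : ℝ) * roughIndicator z l')
      (roughIndicator z) (roughIndicator z) =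
      ∑ r ∈ (Icc 1 ⌊R⌋₊).filter (fun r : ℕ => IsCoprime (r : ℤ) a),
        ∑ l' ∈ (Icc 1 ⌊L * N⌋₊).filter (fun l' : ℕ => l'.Coprime r), (σ 0 l' : ℝ) * F r l' := by
    unfold deltaW qSumW
    simp only [hF, wBracket_rough, mul_assoc]
  rw [hΔ1]
  unfold deltaStar
  refine Finset.sum_le_sum fun r hr => ?_
  exact le_trans (Finset.sum_le_sum fun l hl => hkey r hr l hl) (hfib r hr)

/-! ### The mass of the upper sieve function, and the remainders -/

/-- **Mass of the upper sieve function on the integers coprime to `k`** in a box (the companion of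
`BFI.sum_UL_coprime_le`): `∑_{m ∈ (⌊u⌋,⌊v⌋], (m,k)=1} U(m) ≤ (φ(k)/k)(v−u)(1 + η₁ + (2+2η₁)T_λ) + 2τ(k) N_w`
(`∑_i w⁺_i g_k(d_i) ≤ V₁V₂ + V₁(η₁V₂ + (2+2η₁)T) ≤ 1 + η₁ + (2+2η₁)T_λ` by
`TwoRangeSieve.abs_main_sub_le`, `V₁, V₂ ≤ 1`). [folklore] -/
theorem sum_sieveU_coprime_le {z₁ z D₁ u v lam : ℝ} {r : ℕ} (hz₁ : 2 ≤ z₁) (hz : z₁ ≤ z) (hD1 : 1 < D₁)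
    (hzD : 10 * Real.log z₁ ≤ Real.log D₁) (hu : 0 ≤ u) (huv : u ≤ v) (hlam : 0 < lam) {k : ℕ} (hk : k ≠ 0) :
    ∑ m ∈ Ioc ⌊u⌋₊ ⌊v⌋₊, sieveU z₁ z D₁ r m * (if m.Coprime k then (1 : ℝ) else 0) ≤
      (Nat.totient k : ℝ) / k * (v - u) *
          (1 + (2 * Real.exp 5 ^ 10 * Real.exp (10 - Real.log D₁ / Real.log z₁) +
            (2 + 2 * (2 * Real.exp 5 ^ 10 * Real.exp (10 - Real.log D₁ / Real.log z₁))) *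
              ((lam ^ (2 * r + 1))⁻¹ * Real.exp (lam * Real.log (Real.exp 5 * (Real.log z / Real.log z₁)))))) +
        2 * (σ 0 k : ℝ) * (2 * (D₁ + 1) * ((TwoRangeSieve.midPrimes z₁ z).card + 1 : ℝ) ^ (2 * r + 1)) := by
  set J := TwoRangeSieve.idx z₁ z with hJ
  set w : ℕ × Finset ℕ → ℝ := fun i => TwoRangeSieve.wU D₁ r i with hw
  set g := coprimeRecip k with hg
  set η₁ : ℝ := 2 * Real.exp 5 ^ 10 * Real.exp (10 - Real.log D₁ / Real.log z₁) with hη₁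
  set T₀ : ℝ := (lam ^ (2 * r + 1))⁻¹ * Real.exp (lam * Real.log (Real.exp 5 * (Real.log z / Real.log z₁))) with hT₀
  set Nw : ℝ := 2 * (D₁ + 1) * ((TwoRangeSieve.midPrimes z₁ z).card + 1 : ℝ) ^ (2 * r + 1) with hNw
  have hφk : 0 ≤ (Nat.totient k : ℝ) / k := by positivity
  have hsieveU : ∀ m, sieveU z₁ z D₁ r m = ∑ i ∈ J, w i * (if TwoRangeSieve.modOf i ∣ m then (1 : ℝ) else 0) :=
    fun m => rfl
  simp_rw [hsieveU]
  rw [sum_weightFn_mul_indicator w J _ k]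
  -- compare each count with the density
  have hmain : |∑ i ∈ J, w i * (#((Ioc ⌊u⌋₊ ⌊v⌋₊).filter
      (fun m : ℕ => TwoRangeSieve.modOf i ∣ m ∧ m.Coprime k)) : ℝ) -
      (Nat.totient k : ℝ) / k * (v - u) * ∑ i ∈ J, w i * g (TwoRangeSieve.modOf i)| ≤
      2 * (σ 0 k : ℝ) * ∑ i ∈ J, |w i| := by
    rw [Finset.mul_sum, ← Finset.sum_sub_distrib, Finset.mul_sum]
    refine (Finset.abs_sum_le_sum_abs _ _).trans (Finset.sum_le_sum fun i hi => ?_)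
    have hd0 : 0 < TwoRangeSieve.modOf i := by
      rw [hJ, TwoRangeSieve.idx, Finset.mem_product, Nat.mem_divisors, Finset.mem_powerset] at hi
      unfold TwoRangeSieve.modOf
      refine Nat.mul_pos (Nat.pos_of_ne_zero fun h0 => ?_) (Finset.prod_pos fun p hp =>
        (TwoRangeSieve.prime_of_mem_midPrimes (hi.2 hp)).pos)
      rw [h0] at hi; exact primesProdBelow_ne_zero z₁ (zero_dvd_iff.1 hi.1.1)
    have h := abs_card_dvd_coprime_sub_le hu huv hd0 hk
    rw [show w i * (#((Ioc ⌊u⌋₊ ⌊v⌋₊).filter (fun m : ℕ => TwoRangeSieve.modOf i ∣ m ∧ m.Coprime k)) : ℝ) -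
        (Nat.totient k : ℝ) / k * (v - u) * (w i * g (TwoRangeSieve.modOf i)) =
        w i * ((#((Ioc ⌊u⌋₊ ⌊v⌋₊).filter (fun m : ℕ => TwoRangeSieve.modOf i ∣ m ∧ m.Coprime k)) : ℝ) -
          (Nat.totient k : ℝ) / k * (v - u) * g (TwoRangeSieve.modOf i)) by ring, abs_mul]
    rw [mul_comm (2 * (σ 0 k : ℝ)) |w i|]
    exact mul_le_mul_of_nonneg_left h (abs_nonneg _)
  -- the main term of the upper weights for `g = g_k`
  have hgm := isMultiplicative_coprimeRecip k
  have hdim := hasSieveDimension_coprimeRecip k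
  obtain ⟨hU, -⟩ := TwoRangeSieve.abs_main_sub_le (r := r) hgm hdim z hz₁ hD1 hzD
  obtain ⟨hV₂pos, -, hTb⟩ := TwoRangeSieve.vmid_tail_bounds (r := r) hdim hz₁ hz
  have hT := hTb lam hlam
  set V₁ := BetaSieve.vprod g (primesProdBelow z₁) with hV₁
  set V₂ := TwoRangeSieve.vmid g z₁ z with hV₂
  set T := TwoRangeSieve.tail g z₁ z r with hTdef
  have h01 : ∀ p : ℕ, p.Prime → 0 ≤ g p ∧ g p ≤ 1 := fun p hp => ⟨(hdim.1 p hp).1, (hdim.1 p hp).2.le⟩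
  have hV₁le : V₁ ≤ 1 := by
    rw [hV₁]; unfold BetaSieve.vprod
    exact Finset.prod_le_one (fun p hp => by linarith [(h01 p (Nat.prime_of_mem_primeFactors hp)).2])
      fun p hp => by linarith [(h01 p (Nat.prime_of_mem_primeFactors hp)).1]
  have hV₁0 : 0 ≤ V₁ := BetaSieve.vprod_nonneg fun p hp => h01 p (Nat.prime_of_mem_primeFactors hp)
  have hV₂le : V₂ ≤ 1 := by
    rw [hV₂]; unfold TwoRangeSieve.vmid
    exact Finset.prod_le_one (fun p hp => by linarith [(h01 p (TwoRangeSieve.prime_of_mem_midPrimes hp)).2])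
      fun p hp => by linarith [(h01 p (TwoRangeSieve.prime_of_mem_midPrimes hp)).1]
  have hV₂0 : 0 ≤ V₂ := hV₂pos.le
  have hT0 : 0 ≤ T := Finset.sum_nonneg fun S hS => Finset.prod_nonneg fun p hp =>
    (h01 p (TwoRangeSieve.prime_of_mem_midPrimes ((Finset.mem_powersetCard.1 hS).1 hp))).1
  have hη₁0 : 0 ≤ η₁ := by positivity
  have hdiff : ∑ i ∈ J, w i * g (TwoRangeSieve.modOf i) ≤ 1 + (η₁ + (2 + 2 * η₁) * T₀) := by
    have h1 := (abs_le.1 hU).2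
    have hbound : V₁ * (η₁ * V₂ + (2 + 2 * η₁) * T) ≤ η₁ + (2 + 2 * η₁) * T₀ := by
      calc V₁ * (η₁ * V₂ + (2 + 2 * η₁) * T) ≤ 1 * (η₁ * 1 + (2 + 2 * η₁) * T₀) := by
            refine mul_le_mul hV₁le (add_le_add (mul_le_mul_of_nonneg_left hV₂le hη₁0)
              (mul_le_mul_of_nonneg_left hT (by positivity))) (by positivity) zero_le_one
        _ = _ := by ring
    have hV₁V₂ : V₁ * V₂ ≤ 1 := by nlinarith
    have : ∑ i ∈ J, w i * g (TwoRangeSieve.modOf i) ≤ V₁ * V₂ + V₁ * (η₁ * V₂ + (2 + 2 * η₁) * T) := by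
      rw [hw]; linarith
    linarith
  have habs : ∑ i ∈ J, |w i| ≤ Nw := by
    refine le_trans (Finset.sum_le_sum fun i _ => ?_) (TwoRangeSieve.sum_abs_w_le (z := z) (r := r) hD1 hzD)
    rw [hw]; exact le_add_of_nonneg_right (abs_nonneg _)
  have hτ0 : 0 ≤ (σ 0 k : ℝ) := Nat.cast_nonneg _
  have key := (abs_le.1 hmain).2
  calc ∑ i ∈ J, w i * (#((Ioc ⌊u⌋₊ ⌊v⌋₊).filter (fun m : ℕ => TwoRangeSieve.modOf i ∣ m ∧ m.Coprime k)) : ℝ)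
      ≤ (Nat.totient k : ℝ) / k * (v - u) * ∑ i ∈ J, w i * g (TwoRangeSieve.modOf i) +
          2 * (σ 0 k : ℝ) * ∑ i ∈ J, |w i| := by linarith
    _ ≤ (Nat.totient k : ℝ) / k * (v - u) * (1 + (η₁ + (2 + 2 * η₁) * T₀)) + 2 * (σ 0 k : ℝ) * Nw :=
        add_le_add (mul_le_mul_of_nonneg_left hdiff (mul_nonneg hφk (by linarith)))
          (mul_le_mul_of_nonneg_left habs (by positivity))

/-- `(U − L) ≥ 0` summed against a coprimality condition in `[1, ⌊M⌋]` is nonnegative and bounded by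
`BFI.sum_UL_coprime_le`, restated for the sieve functions of this file. [folklore] -/
theorem sum_sieveUL_coprime_bounds {z₁ z D₁ M lam : ℝ} {r : ℕ} (hz₁ : 2 ≤ z₁) (hz : z₁ ≤ z) (hD1 : 1 < D₁)
    (hzD : 10 * Real.log z₁ ≤ Real.log D₁) (hM : 0 ≤ M) (hlam : 0 < lam) {k : ℕ} (hk : k ≠ 0) :
    0 ≤ ∑ m ∈ Icc 1 ⌊M⌋₊, (sieveU z₁ z D₁ r m - sieveL z₁ z D₁ r m) * (if m.Coprime k then (1 : ℝ) else 0) ∧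
    ∑ m ∈ Icc 1 ⌊M⌋₊, (sieveU z₁ z D₁ r m - sieveL z₁ z D₁ r m) * (if m.Coprime k then (1 : ℝ) else 0) ≤
      (Nat.totient k : ℝ) / k * M *
          (2 * (2 * Real.exp 5 ^ 10 * Real.exp (10 - Real.log D₁ / Real.log z₁) +
            (2 + 2 * (2 * Real.exp 5 ^ 10 * Real.exp (10 - Real.log D₁ / Real.log z₁))) *
              ((lam ^ (2 * r + 1))⁻¹ * Real.exp (lam * Real.log (Real.exp 5 * (Real.log z / Real.log z₁)))))) +
        4 * (σ 0 k : ℝ) * (2 * (D₁ + 1) * ((TwoRangeSieve.midPrimes z₁ z).card + 1 : ℝ) ^ (2 * r + 1)) := by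
  constructor
  · refine Finset.sum_nonneg fun m hm => ?_
    rw [Finset.mem_Icc] at hm
    exact mul_nonneg (sieveU_sub_sieveL_nonneg hz D₁ r (by omega)) (by split_ifs <;> norm_num)
  · have h := sum_UL_coprime_le (r := r) hz₁ hz hD1 hzD (le_refl (0 : ℝ)) hM hlam hk
    rw [Nat.floor_zero, sub_zero] at h
    rw [show Icc 1 ⌊M⌋₊ = Ioc 0 ⌊M⌋₊ from Finset.Icc_succ_left_eq_Ioc 0 _]
    refine le_trans (le_of_eq (Finset.sum_congr rfl fun m _ => ?_)) h
    unfold sieveU sieveL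
    rw [← Finset.sum_sub_distrib]
    congr 1
    exact Finset.sum_congr rfl fun i _ => by ring

/-- `U ≥ 0` summed against a coprimality condition in `[1, ⌊M⌋]`: nonnegative, and bounded by
`sum_sieveU_coprime_le`. [folklore] -/
theorem sum_sieveU_coprime_bounds {z₁ z D₁ M lam : ℝ} {r : ℕ} (hz₁ : 2 ≤ z₁) (hz : z₁ ≤ z) (hD1 : 1 < D₁)
    (hzD : 10 * Real.log z₁ ≤ Real.log D₁) (hM : 0 ≤ M) (hlam : 0 < lam) {k : ℕ} (hk : k ≠ 0) :
    0 ≤ ∑ m ∈ Icc 1 ⌊M⌋₊, sieveU z₁ z D₁ r m * (if m.Coprime k then (1 : ℝ) else 0) ∧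
    ∑ m ∈ Icc 1 ⌊M⌋₊, sieveU z₁ z D₁ r m * (if m.Coprime k then (1 : ℝ) else 0) ≤
      (Nat.totient k : ℝ) / k * M *
          (1 + (2 * Real.exp 5 ^ 10 * Real.exp (10 - Real.log D₁ / Real.log z₁) +
            (2 + 2 * (2 * Real.exp 5 ^ 10 * Real.exp (10 - Real.log D₁ / Real.log z₁))) *
              ((lam ^ (2 * r + 1))⁻¹ * Real.exp (lam * Real.log (Real.exp 5 * (Real.log z / Real.log z₁)))))) +
        2 * (σ 0 k : ℝ) * (2 * (D₁ + 1) * ((TwoRangeSieve.midPrimes z₁ z).card + 1 : ℝ) ^ (2 * r + 1)) := by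
  constructor
  · refine Finset.sum_nonneg fun m hm => ?_
    rw [Finset.mem_Icc] at hm
    exact mul_nonneg (sieveU_nonneg hz D₁ r (by omega)) (by split_ifs <;> norm_num)
  · have h := sum_sieveU_coprime_le (r := r) hz₁ hz hD1 hzD (le_refl (0 : ℝ)) hM hlam hk
    rw [Nat.floor_zero, sub_zero] at h
    rwa [show Icc 1 ⌊M⌋₊ = Ioc 0 ⌊M⌋₊ from Finset.Icc_succ_left_eq_Ioc 0 _]

/-- **Generic bound for the remainders of the sandwich.**  If `ωl ≥ 0` with
`∑_{l ≤ L, (l,r)=1} ωl ≤ Λ` for every `r`, and for all `k ≥ 1` the two inner sums are nonnegative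
with `∑_n ωn(n)1_{(n,k)=1} ≤ A τ(k)`, `∑_m W(m)1_{(m,k)=1} ≤ B τ(k)` (`A, B, Λ ≥ 0`), then
`Rem(ωl, ωn, W) ≤ Λ A B ∑_{r ≤ R} ∑_{q ≤ Q} τ(qr)²/φ(qr)`. [folklore] -/
theorem remainder_le {a : ℤ} {M N L Q R : ℝ} {ωl ωn W : ℕ → ℝ} {Λ A B : ℝ}
    (hωl : ∀ l, 0 ≤ ωl l) (hΛ0 : 0 ≤ Λ)
    (hΛ : ∀ r : ℕ, ∑ l ∈ (Icc 1 ⌊L⌋₊).filter (fun l : ℕ => l.Coprime r), ωl l ≤ Λ)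
    (hA0 : 0 ≤ A) (hB0 : 0 ≤ B)
    (hA : ∀ k : ℕ, k ≠ 0 → 0 ≤ ∑ n ∈ Icc 1 ⌊N⌋₊, ωn n * (if n.Coprime k then (1 : ℝ) else 0) ∧
      ∑ n ∈ Icc 1 ⌊N⌋₊, ωn n * (if n.Coprime k then (1 : ℝ) else 0) ≤ A * (σ 0 k : ℝ))
    (hB : ∀ k : ℕ, k ≠ 0 → 0 ≤ ∑ m ∈ Icc 1 ⌊M⌋₊, W m * (if m.Coprime k then (1 : ℝ) else 0) ∧
      ∑ m ∈ Icc 1 ⌊M⌋₊, W m * (if m.Coprime k then (1 : ℝ) else 0) ≤ B * (σ 0 k : ℝ)) :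
    ∑ r ∈ (Icc 1 ⌊R⌋₊).filter (fun r : ℕ => IsCoprime (r : ℤ) a),
        ∑ l ∈ (Icc 1 ⌊L⌋₊).filter (fun l : ℕ => l.Coprime r), ωl l *
          ∑ q ∈ (Icc 1 ⌊Q⌋₊).filter (fun q : ℕ => IsCoprime (q : ℤ) (a * l)),
            ((Nat.totient (q * r) : ℝ))⁻¹ *
              ((∑ n ∈ Icc 1 ⌊N⌋₊, ωn n * (if n.Coprime (q * r) then (1 : ℝ) else 0)) *
                (∑ m ∈ Icc 1 ⌊M⌋₊, W m * (if m.Coprime (q * r) then (1 : ℝ) else 0))) ≤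
      Λ * A * B * ∑ r ∈ Icc 1 ⌊R⌋₊, ∑ q ∈ Icc 1 ⌊Q⌋₊,
        (σ 0 (q * r) : ℝ) ^ 2 / (Nat.totient (q * r) : ℝ) := by
  -- the inner `q`-sum for fixed `r, l`
  set G : ℕ → ℝ := fun r => ∑ q ∈ Icc 1 ⌊Q⌋₊, (σ 0 (q * r) : ℝ) ^ 2 / (Nat.totient (q * r) : ℝ) with hG
  have hG0 : ∀ r, 0 ≤ G r := fun r => Finset.sum_nonneg fun q _ => by positivity
  have hinner : ∀ r ∈ (Icc 1 ⌊R⌋₊).filter (fun r : ℕ => IsCoprime (r : ℤ) a), ∀ l : ℕ,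
      ∑ q ∈ (Icc 1 ⌊Q⌋₊).filter (fun q : ℕ => IsCoprime (q : ℤ) (a * l)),
        ((Nat.totient (q * r) : ℝ))⁻¹ *
          ((∑ n ∈ Icc 1 ⌊N⌋₊, ωn n * (if n.Coprime (q * r) then (1 : ℝ) else 0)) *
            (∑ m ∈ Icc 1 ⌊M⌋₊, W m * (if m.Coprime (q * r) then (1 : ℝ) else 0))) ≤
        A * B * G r := by
    intro r hr l
    rw [Finset.mem_filter, Finset.mem_Icc] at hr
    have hterm : ∀ q ∈ Icc 1 ⌊Q⌋₊, ((Nat.totient (q * r) : ℝ))⁻¹ *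
        ((∑ n ∈ Icc 1 ⌊N⌋₊, ωn n * (if n.Coprime (q * r) then (1 : ℝ) else 0)) *
          (∑ m ∈ Icc 1 ⌊M⌋₊, W m * (if m.Coprime (q * r) then (1 : ℝ) else 0))) ≤
        A * B * ((σ 0 (q * r) : ℝ) ^ 2 / (Nat.totient (q * r) : ℝ)) := by
      intro q hq
      rw [Finset.mem_Icc] at hq
      have hk : q * r ≠ 0 := mul_ne_zero (by omega) (by omega)
      obtain ⟨hA1, hA2⟩ := hA _ hk
      obtain ⟨hB1, hB2⟩ := hB _ hk
      have hφ : 0 ≤ ((Nat.totient (q * r) : ℝ))⁻¹ := inv_nonneg.2 (Nat.cast_nonneg _)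
      calc ((Nat.totient (q * r) : ℝ))⁻¹ * (_ * _)
          ≤ ((Nat.totient (q * r) : ℝ))⁻¹ * ((A * (σ 0 (q * r) : ℝ)) * (B * (σ 0 (q * r) : ℝ))) :=
            mul_le_mul_of_nonneg_left (mul_le_mul hA2 hB2 hB1 (by positivity)) hφ
        _ = A * B * ((σ 0 (q * r) : ℝ) ^ 2 / (Nat.totient (q * r) : ℝ)) := by ring
    have hnn : ∀ q ∈ Icc 1 ⌊Q⌋₊, 0 ≤ ((Nat.totient (q * r) : ℝ))⁻¹ *
        ((∑ n ∈ Icc 1 ⌊N⌋₊, ωn n * (if n.Coprime (q * r) then (1 : ℝ) else 0)) *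
          (∑ m ∈ Icc 1 ⌊M⌋₊, W m * (if m.Coprime (q * r) then (1 : ℝ) else 0))) := by
      intro q hq
      rw [Finset.mem_Icc] at hq
      have hk : q * r ≠ 0 := mul_ne_zero (by omega) (by omega)
      exact mul_nonneg (inv_nonneg.2 (Nat.cast_nonneg _)) (mul_nonneg (hA _ hk).1 (hB _ hk).1)
    calc _ ≤ ∑ q ∈ Icc 1 ⌊Q⌋₊, ((Nat.totient (q * r) : ℝ))⁻¹ *
            ((∑ n ∈ Icc 1 ⌊N⌋₊, ωn n * (if n.Coprime (q * r) then (1 : ℝ) else 0)) *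
              (∑ m ∈ Icc 1 ⌊M⌋₊, W m * (if m.Coprime (q * r) then (1 : ℝ) else 0))) :=
          Finset.sum_le_sum_of_subset_of_nonneg (Finset.filter_subset _ _) fun q hq _ => hnn q hq
      _ ≤ ∑ q ∈ Icc 1 ⌊Q⌋₊, A * B * ((σ 0 (q * r) : ℝ) ^ 2 / (Nat.totient (q * r) : ℝ)) :=
          Finset.sum_le_sum hterm
      _ = A * B * G r := by rw [hG, Finset.mul_sum]
  calc _ ≤ ∑ r ∈ (Icc 1 ⌊R⌋₊).filter (fun r : ℕ => IsCoprime (r : ℤ) a),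
          ∑ l ∈ (Icc 1 ⌊L⌋₊).filter (fun l : ℕ => l.Coprime r), ωl l * (A * B * G r) :=
        Finset.sum_le_sum fun r hr => Finset.sum_le_sum fun l _ =>
          mul_le_mul_of_nonneg_left (hinner r hr l) (hωl l)
    _ = ∑ r ∈ (Icc 1 ⌊R⌋₊).filter (fun r : ℕ => IsCoprime (r : ℤ) a),
          (∑ l ∈ (Icc 1 ⌊L⌋₊).filter (fun l : ℕ => l.Coprime r), ωl l) * (A * B * G r) := by
        refine Finset.sum_congr rfl fun r _ => ?_
        rw [Finset.sum_mul]
    _ ≤ ∑ r ∈ (Icc 1 ⌊R⌋₊).filter (fun r : ℕ => IsCoprime (r : ℤ) a), Λ * (A * B * G r) :=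
        Finset.sum_le_sum fun r _ => mul_le_mul_of_nonneg_right (hΛ r)
          (mul_nonneg (mul_nonneg hA0 hB0) (hG0 r))
    _ ≤ ∑ r ∈ Icc 1 ⌊R⌋₊, Λ * (A * B * G r) :=
        Finset.sum_le_sum_of_subset_of_nonneg (Finset.filter_subset _ _) fun r _ _ =>
          mul_nonneg hΛ0 (mul_nonneg (mul_nonneg hA0 hB0) (hG0 r))
    _ = _ := by rw [hG, Finset.mul_sum]; exact Finset.sum_congr rfl fun r _ => by ring

/-- `∑_{r ≤ R} ∑_{q ≤ Q} τ(qr)²/φ(qr) ≤ (∑_{q ≤ Q} τ(q)³/q)(∑_{r ≤ R} τ(r)³/r)`. [folklore] -/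
theorem sum_sum_sigma_sq_div_totient_le (Q' R' : ℕ) :
    ∑ r ∈ Icc 1 R', ∑ q ∈ Icc 1 Q', (σ 0 (q * r) : ℝ) ^ 2 / (Nat.totient (q * r) : ℝ) ≤
      (∑ q ∈ Icc 1 Q', (σ 0 q : ℝ) ^ 3 / q) * (∑ r ∈ Icc 1 R', (σ 0 r : ℝ) ^ 3 / r) := by
  rw [mul_comm, Finset.sum_mul]
  refine Finset.sum_le_sum fun r hr => ?_
  rw [Finset.mul_sum]
  refine Finset.sum_le_sum fun q hq => ?_
  rw [Finset.mem_Icc] at hr hq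
  have hq0 : (0 : ℝ) < q := by exact_mod_cast hq.1
  have hr0 : (0 : ℝ) < r := by exact_mod_cast hr.1
  have hτ : (σ 0 (q * r) : ℝ) ≤ (σ 0 q : ℝ) * (σ 0 r : ℝ) := by exact_mod_cast sigma_zero_mul_le q r
  have hφ : ((Nat.totient (q * r) : ℝ))⁻¹ ≤ (σ 0 (q * r) : ℝ) / (q * r : ℕ) :=
    inv_totient_le_sigma_zero_div (q * r)
  have hτ0 : (0 : ℝ) ≤ (σ 0 (q * r) : ℝ) := Nat.cast_nonneg _
  calc (σ 0 (q * r) : ℝ) ^ 2 / (Nat.totient (q * r) : ℝ)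
      = (σ 0 (q * r) : ℝ) ^ 2 * ((Nat.totient (q * r) : ℝ))⁻¹ := div_eq_mul_inv _ _
    _ ≤ ((σ 0 q : ℝ) * (σ 0 r : ℝ)) ^ 2 * (((σ 0 q : ℝ) * (σ 0 r : ℝ)) / (q * r : ℕ)) := by
        refine mul_le_mul (pow_le_pow_left₀ hτ0 hτ 2) (hφ.trans ?_) (inv_nonneg.2 (Nat.cast_nonneg _))
          (by positivity)
        exact div_le_div_of_nonneg_right hτ (Nat.cast_nonneg _)
    _ = (σ 0 r : ℝ) ^ 3 / r * ((σ 0 q : ℝ) ^ 3 / q) := by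
        have hq0' : (q : ℝ) ≠ 0 := hq0.ne'
        have hr0' : (r : ℝ) ≠ 0 := hr0.ne'
        push_cast
        field_simp

/-- `∑_{r ≤ R} ∑_{q ≤ Q} τ(qr)²/φ(qr) ≤ C (1 + log Q)¹⁶ (1 + log R)¹⁶` for `Q, R ≥ 1`. [folklore] -/
theorem sum_sum_sigma_sq_div_totient_le_log :
    ∃ C : ℝ, 0 < C ∧ ∀ Q R : ℝ, 1 ≤ Q → 1 ≤ R →
      ∑ r ∈ Icc 1 ⌊R⌋₊, ∑ q ∈ Icc 1 ⌊Q⌋₊, (σ 0 (q * r) : ℝ) ^ 2 / (Nat.totient (q * r) : ℝ) ≤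
        C * (1 + Real.log Q) ^ 16 * (1 + Real.log R) ^ 16 := by
  obtain ⟨C₁, hC₁, h₁⟩ := exists_sum_sigma_zero_pow_div_le_real 3
  refine ⟨C₁ ^ 2, by positivity, fun Q R hQ hR => ?_⟩
  have hdiv : ∀ Y : ℝ, 1 ≤ Y → ∑ n ∈ Icc 1 ⌊Y⌋₊, (σ 0 n : ℝ) ^ 3 / n ≤ C₁ * (1 + Real.log Y) ^ 16 := by
    intro Y hY
    have hY2 : (2 : ℝ) ≤ max Y 2 := le_max_right _ _
    have hsub : Icc 1 ⌊Y⌋₊ ⊆ Icc 1 ⌊max Y 2⌋₊ :=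
      Finset.Icc_subset_Icc_right (Nat.floor_mono (le_max_left _ _))
    have hlog : Real.log (max Y 2) ≤ 1 + Real.log Y := by
      rcases le_total Y 2 with h | h
      · rw [max_eq_right h]
        have : Real.log 2 ≤ 1 := by
          have := Real.log_two_lt_d9; norm_num at this; linarith
        linarith [Real.log_nonneg hY]
      · rw [max_eq_left h]; linarith
    have hlog0 : 0 ≤ Real.log (max Y 2) := Real.log_nonneg (by linarith)
    calc ∑ n ∈ Icc 1 ⌊Y⌋₊, (σ 0 n : ℝ) ^ 3 / n ≤ ∑ n ∈ Icc 1 ⌊max Y 2⌋₊, (σ 0 n : ℝ) ^ 3 / n :=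
          Finset.sum_le_sum_of_subset_of_nonneg hsub fun n _ _ => by positivity
      _ ≤ C₁ * Real.log (max Y 2) ^ (2 ^ (3 + 1)) := h₁ _ hY2
      _ ≤ C₁ * (1 + Real.log Y) ^ 16 := by
          norm_num
          exact mul_le_mul_of_nonneg_left (pow_le_pow_left₀ hlog0 hlog 16) hC₁.le
  have h0 : 0 ≤ ∑ r ∈ Icc 1 ⌊R⌋₊, (σ 0 r : ℝ) ^ 3 / r := Finset.sum_nonneg fun r _ => by positivity
  calc _ ≤ (∑ q ∈ Icc 1 ⌊Q⌋₊, (σ 0 q : ℝ) ^ 3 / q) * (∑ r ∈ Icc 1 ⌊R⌋₊, (σ 0 r : ℝ) ^ 3 / r) :=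
        sum_sum_sigma_sq_div_totient_le _ _
    _ ≤ (C₁ * (1 + Real.log Q) ^ 16) * (C₁ * (1 + Real.log R) ^ 16) :=
        mul_le_mul (hdiv Q hQ) (hdiv R hR) h0 (by have := hdiv Q hQ; positivity)
    _ = C₁ ^ 2 * (1 + Real.log Q) ^ 16 * (1 + Real.log R) ^ 16 := by ring


/-! ### The one-variable and the two-variable sieve inequalities -/

/-- The main-term discrepancy `E₀ = 2(η₁ + (2+2η₁)T_λ)` of the two-range sieve of level `D₁` split at
`z₁`, Brun depth `2r+1`, for densities of dimension `1` with constant `K = e⁵` (the shape produced by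
`TwoRangeSieve.abs_main_sub_le` and `vmid_tail_bounds`). [folklore] -/
noncomputable def sieveErr (z₁ z D₁ lam : ℝ) (rr : ℕ) : ℝ :=
  2 * (2 * Real.exp 5 ^ 10 * Real.exp (10 - Real.log D₁ / Real.log z₁) +
    (2 + 2 * (2 * Real.exp 5 ^ 10 * Real.exp (10 - Real.log D₁ / Real.log z₁))) *
      ((lam ^ (2 * rr + 1))⁻¹ * Real.exp (lam * Real.log (Real.exp 5 * (Real.log z / Real.log z₁)))))

/-- The total mass bound `N_w = 2(D₁+1)(#𝒫₂+1)^{2r+1}` of the two-range weights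
(`TwoRangeSieve.sum_abs_w_le`). [folklore] -/
noncomputable def sieveMass (z₁ z D₁ : ℝ) (rr : ℕ) : ℝ :=
  2 * (D₁ + 1) * ((TwoRangeSieve.midPrimes z₁ z).card + 1 : ℝ) ^ (2 * rr + 1)

/-- `E₀ ≥ 0`. [folklore] -/
theorem sieveErr_nonneg (z₁ z D₁ : ℝ) {lam : ℝ} (hlam : 0 < lam) (rr : ℕ) : 0 ≤ sieveErr z₁ z D₁ lam rr := by
  unfold sieveErr; positivity

/-- `N_w ≥ 0` for `D₁ ≥ 0`. [folklore] -/
theorem sieveMass_nonneg (z₁ z : ℝ) {D₁ : ℝ} (hD : 0 ≤ D₁) (rr : ℕ) : 0 ≤ sieveMass z₁ z D₁ rr := by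
  unfold sieveMass; positivity

/-- `U − L` as a weighted divisor sum. [folklore] -/
theorem sieveU_sub_sieveL_eq (z₁ z D₁ : ℝ) (rr : ℕ) (m : ℕ) :
    sieveU z₁ z D₁ rr m - sieveL z₁ z D₁ rr m =
      ∑ i ∈ TwoRangeSieve.idx z₁ z, (TwoRangeSieve.wU D₁ rr i - TwoRangeSieve.wL D₁ rr i) *
        (if TwoRangeSieve.modOf i ∣ m then (1 : ℝ) else 0) := by
  unfold sieveU sieveL
  rw [← Finset.sum_sub_distrib]
  exact Finset.sum_congr rfl fun i _ => by ring

/-- Moduli of the two-range index set are positive. [folklore] -/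
theorem modOf_pos_of_mem_idx {z₁ z : ℝ} {i : ℕ × Finset ℕ} (hi : i ∈ TwoRangeSieve.idx z₁ z) :
    0 < TwoRangeSieve.modOf i := by
  rw [TwoRangeSieve.idx, Finset.mem_product, Nat.mem_divisors, Finset.mem_powerset] at hi
  unfold TwoRangeSieve.modOf
  refine Nat.mul_pos (Nat.pos_of_ne_zero fun h0 => ?_) (Finset.prod_pos fun p hp =>
    (TwoRangeSieve.prime_of_mem_midPrimes (hi.2 hp)).pos)
  rw [h0] at hi; exact primesProdBelow_ne_zero z₁ (zero_dvd_iff.1 hi.1.1)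

/-- **ONE-VARIABLE EXPANSION with the two-range weights.**  For a weight `w` dominated by the
two-range weights (`|w| ≤ |w⁺| + |w⁻|`, supported where one of them is nonzero), `0 ≤ ωl ≤ T` on
`l ≤ L`, and a bound `B_d` for the pieces `deltaW(M/d, N, L d; 1, 1, ωn)` at all `d` below the level
`D₁ z^{2r+1}`: `deltaW(M, N, L; ωl, ∑_i w_i 1_{d(i)∣·}, ωn) ≤ T · B_d · N_w`. [folklore] -/
theorem deltaW_weight_le {z₁ z D₁ : ℝ} {rr : ℕ} (hD1 : 1 < D₁) (hzD : 10 * Real.log z₁ ≤ Real.log D₁)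
    (hz1 : 1 ≤ z) (w : ℕ × Finset ℕ → ℝ)
    (hw : ∀ i, |w i| ≤ |TwoRangeSieve.wU D₁ rr i| + |TwoRangeSieve.wL D₁ rr i|)
    (hwsupp : ∀ i ∈ TwoRangeSieve.idx z₁ z, w i ≠ 0 →
      TwoRangeSieve.wU D₁ rr i ≠ 0 ∨ TwoRangeSieve.wL D₁ rr i ≠ 0)
    {ωl : ℕ → ℝ} {T L : ℝ} (hT : 0 ≤ T) (hωl0 : ∀ l, 0 ≤ ωl l) (hωl1 : ∀ l ∈ Icc 1 ⌊L⌋₊, ωl l ≤ T)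
    (a : ℤ) {M : ℝ} (hM : 0 ≤ M) (N Q R : ℝ) (ωn : ℕ → ℝ) {Bd : ℝ} (hBd0 : 0 ≤ Bd)
    (hBd : ∀ d : ℕ, 0 < d → (d : ℝ) < D₁ * z ^ (2 * rr + 1) →
      deltaW a (M / d) N (L * d) Q R (fun _ => 1) (fun _ => 1) ωn ≤ Bd) :
    deltaW a M N L Q R ωl (fun m => ∑ i ∈ TwoRangeSieve.idx z₁ z, w i *
      (if TwoRangeSieve.modOf i ∣ m then (1 : ℝ) else 0)) ωn ≤ T * (Bd * sieveMass z₁ z D₁ rr) := by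
  set J := TwoRangeSieve.idx z₁ z with hJ
  have hexp := deltaW_le_of_divisorWeight J w (dv := fun i => TwoRangeSieve.modOf i)
    (fun i hi => modOf_pos_of_mem_idx hi) hT hωl0 hωl1 a hM N Q R ωn
  refine hexp.trans (mul_le_mul_of_nonneg_left ?_ hT)
  -- the pieces with nonzero weight are below the level
  have hX0 : ∀ i, 0 ≤ deltaW a (M / TwoRangeSieve.modOf i) N (L * TwoRangeSieve.modOf i) Q R
      (fun _ => 1) (fun _ => 1) ωn := fun i => deltaW_nonneg (fun _ => zero_le_one) _ _ _ _ _ _ _ _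
  have h1 : ∑ i ∈ J, |w i| * deltaW a (M / TwoRangeSieve.modOf i) N (L * TwoRangeSieve.modOf i) Q R
      (fun _ => 1) (fun _ => 1) ωn ≤ Bd * ∑ i ∈ J, |w i| := by
    rw [Finset.mul_sum]
    refine Finset.sum_le_sum fun i hi => ?_
    by_cases hwi : w i = 0
    · rw [hwi, abs_zero, zero_mul, mul_zero]
    · have hlt := TwoRangeSieve.modOf_lt (r := rr) hD1 hzD hz1 hi (hwsupp i hi hwi)
      rw [mul_comm]
      exact mul_le_mul_of_nonneg_right (hBd _ (modOf_pos_of_mem_idx hi) hlt) (abs_nonneg _)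
  have h2 : ∑ i ∈ J, |w i| ≤ sieveMass z₁ z D₁ rr := by
    refine le_trans (Finset.sum_le_sum fun i _ => hw i) ?_
    unfold sieveMass
    exact TwoRangeSieve.sum_abs_w_le (z := z) (r := rr) hD1 hzD
  exact h1.trans (mul_le_mul_of_nonneg_left h2 hBd0)

/-- `deltaW` with the upper sieve function on `m`, expanded. [folklore] -/
theorem deltaW_sieveU_le {z₁ z D₁ : ℝ} {rr : ℕ} (hD1 : 1 < D₁) (hzD : 10 * Real.log z₁ ≤ Real.log D₁)
    (hz1 : 1 ≤ z) {ωl : ℕ → ℝ} {T L : ℝ} (hT : 0 ≤ T) (hωl0 : ∀ l, 0 ≤ ωl l)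
    (hωl1 : ∀ l ∈ Icc 1 ⌊L⌋₊, ωl l ≤ T) (a : ℤ) {M : ℝ} (hM : 0 ≤ M) (N Q R : ℝ) (ωn : ℕ → ℝ)
    {Bd : ℝ} (hBd0 : 0 ≤ Bd)
    (hBd : ∀ d : ℕ, 0 < d → (d : ℝ) < D₁ * z ^ (2 * rr + 1) →
      deltaW a (M / d) N (L * d) Q R (fun _ => 1) (fun _ => 1) ωn ≤ Bd) :
    deltaW a M N L Q R ωl (sieveU z₁ z D₁ rr) ωn ≤ T * (Bd * sieveMass z₁ z D₁ rr) :=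
  deltaW_weight_le hD1 hzD hz1 _ (fun _ => le_add_of_nonneg_right (abs_nonneg _))
    (fun _ _ h => Or.inl h) hT hωl0 hωl1 a hM N Q R ωn hBd0 hBd

/-- `deltaW` with `U − L` on `m`, expanded. [folklore] -/
theorem deltaW_sieveUL_le {z₁ z D₁ : ℝ} {rr : ℕ} (hD1 : 1 < D₁) (hzD : 10 * Real.log z₁ ≤ Real.log D₁)
    (hz1 : 1 ≤ z) {ωl : ℕ → ℝ} {T L : ℝ} (hT : 0 ≤ T) (hωl0 : ∀ l, 0 ≤ ωl l)
    (hωl1 : ∀ l ∈ Icc 1 ⌊L⌋₊, ωl l ≤ T) (a : ℤ) {M : ℝ} (hM : 0 ≤ M) (N Q R : ℝ) (ωn : ℕ → ℝ)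
    {Bd : ℝ} (hBd0 : 0 ≤ Bd)
    (hBd : ∀ d : ℕ, 0 < d → (d : ℝ) < D₁ * z ^ (2 * rr + 1) →
      deltaW a (M / d) N (L * d) Q R (fun _ => 1) (fun _ => 1) ωn ≤ Bd) :
    deltaW a M N L Q R ωl (fun m => sieveU z₁ z D₁ rr m - sieveL z₁ z D₁ rr m) ωn ≤
      T * (Bd * sieveMass z₁ z D₁ rr) := by
  have heq : (fun m => sieveU z₁ z D₁ rr m - sieveL z₁ z D₁ rr m) =
      fun m => ∑ i ∈ TwoRangeSieve.idx z₁ z, (TwoRangeSieve.wU D₁ rr i - TwoRangeSieve.wL D₁ rr i) *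
        (if TwoRangeSieve.modOf i ∣ m then (1 : ℝ) else 0) := funext (sieveU_sub_sieveL_eq z₁ z D₁ rr)
  rw [heq]
  refine deltaW_weight_le hD1 hzD hz1 _ (fun _ => abs_sub _ _) (fun _ _ h => ?_) hT hωl0 hωl1 a hM N Q R ωn
    hBd0 hBd
  by_contra hcon
  push Not at hcon
  exact h (by rw [hcon.1, hcon.2, sub_zero])

/-- Sums of a bounded weight against a coprimality condition: `0 ≤ ∑_{n ≤ N} ω(n)1_{(n,k)=1} ≤ N τ(k)`
for `0 ≤ ω ≤ 1`, `N ≥ 0`, `k ≥ 1`. [folklore] -/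
theorem sum_weight_coprime_bounds {ω : ℕ → ℝ} (h0 : ∀ n, 0 ≤ ω n) (h1 : ∀ n, ω n ≤ 1) {N : ℝ}
    (hN : 0 ≤ N) {k : ℕ} (hk : k ≠ 0) :
    0 ≤ ∑ n ∈ Icc 1 ⌊N⌋₊, ω n * (if n.Coprime k then (1 : ℝ) else 0) ∧
      ∑ n ∈ Icc 1 ⌊N⌋₊, ω n * (if n.Coprime k then (1 : ℝ) else 0) ≤ N * (σ 0 k : ℝ) := by
  have hτ : (1 : ℝ) ≤ σ 0 k := by exact_mod_cast one_le_sigma_zero hk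
  constructor
  · exact Finset.sum_nonneg fun n _ => mul_nonneg (h0 n) (by split_ifs <;> norm_num)
  · calc ∑ n ∈ Icc 1 ⌊N⌋₊, ω n * (if n.Coprime k then (1 : ℝ) else 0)
        ≤ ∑ _n ∈ Icc 1 ⌊N⌋₊, (1 : ℝ) := Finset.sum_le_sum fun n _ => by
          calc ω n * (if n.Coprime k then (1 : ℝ) else 0) ≤ 1 * 1 :=
                mul_le_mul (h1 n) (by split_ifs <;> norm_num) (by split_ifs <;> norm_num) zero_le_one
            _ = 1 := one_mul _
      _ = ⌊N⌋₊ := by rw [Finset.sum_const, Nat.card_Icc, nsmul_eq_mul, mul_one]; push_cast; ring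
      _ ≤ N * 1 := by rw [mul_one]; exact Nat.floor_le hN
      _ ≤ N * (σ 0 k : ℝ) := mul_le_mul_of_nonneg_left hτ hN

/-- The bounds of `sum_sieveUL_coprime_bounds` and `sum_sieveU_coprime_bounds` as multiples of `τ(k)`
(`φ(k)/k ≤ 1 ≤ τ(k)`). [folklore] -/
theorem sum_sieve_coprime_tau_bounds {z₁ z D₁ M lam : ℝ} {rr : ℕ} (hz₁ : 2 ≤ z₁) (hz : z₁ ≤ z)
    (hD1 : 1 < D₁) (hzD : 10 * Real.log z₁ ≤ Real.log D₁) (hM : 0 ≤ M) (hlam : 0 < lam) {k : ℕ}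
    (hk : k ≠ 0) :
    (0 ≤ ∑ m ∈ Icc 1 ⌊M⌋₊, (sieveU z₁ z D₁ rr m - sieveL z₁ z D₁ rr m) * (if m.Coprime k then (1 : ℝ) else 0) ∧
      ∑ m ∈ Icc 1 ⌊M⌋₊, (sieveU z₁ z D₁ rr m - sieveL z₁ z D₁ rr m) * (if m.Coprime k then (1 : ℝ) else 0) ≤
        (M * sieveErr z₁ z D₁ lam rr + 4 * sieveMass z₁ z D₁ rr) * (σ 0 k : ℝ)) ∧
    (0 ≤ ∑ m ∈ Icc 1 ⌊M⌋₊, sieveU z₁ z D₁ rr m * (if m.Coprime k then (1 : ℝ) else 0) ∧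
      ∑ m ∈ Icc 1 ⌊M⌋₊, sieveU z₁ z D₁ rr m * (if m.Coprime k then (1 : ℝ) else 0) ≤
        (M * (1 + sieveErr z₁ z D₁ lam rr / 2) + 2 * sieveMass z₁ z D₁ rr) * (σ 0 k : ℝ)) := by
  have hτ : (1 : ℝ) ≤ σ 0 k := by exact_mod_cast one_le_sigma_zero hk
  have hk0 : (0 : ℝ) < k := by exact_mod_cast Nat.pos_of_ne_zero hk
  have hφk : (Nat.totient k : ℝ) / k ≤ 1 := by
    rw [div_le_one hk0]; exact_mod_cast Nat.totient_le k
  have hφk0 : 0 ≤ (Nat.totient k : ℝ) / k := by positivity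
  have hE0 := sieveErr_nonneg z₁ z D₁ hlam rr
  have hNw0 : 0 ≤ sieveMass z₁ z D₁ rr := sieveMass_nonneg z₁ z (by linarith) rr
  obtain ⟨hUL0, hUL⟩ := sum_sieveUL_coprime_bounds (r := rr) hz₁ hz hD1 hzD hM hlam hk
  obtain ⟨hU0, hU⟩ := sum_sieveU_coprime_bounds (r := rr) hz₁ hz hD1 hzD hM hlam hk
  refine ⟨⟨hUL0, hUL.trans ?_⟩, ⟨hU0, hU.trans ?_⟩⟩
  · change (Nat.totient k : ℝ) / k * M * sieveErr z₁ z D₁ lam rr +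
        4 * (σ 0 k : ℝ) * sieveMass z₁ z D₁ rr ≤ _
    have h1 : (Nat.totient k : ℝ) / k * M * sieveErr z₁ z D₁ lam rr ≤ M * sieveErr z₁ z D₁ lam rr * (σ 0 k : ℝ) := by
      calc (Nat.totient k : ℝ) / k * M * sieveErr z₁ z D₁ lam rr ≤ 1 * M * sieveErr z₁ z D₁ lam rr := by
            gcongr
        _ = M * sieveErr z₁ z D₁ lam rr * 1 := by ring
        _ ≤ M * sieveErr z₁ z D₁ lam rr * (σ 0 k : ℝ) :=
            mul_le_mul_of_nonneg_left hτ (mul_nonneg hM hE0)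
    nlinarith
  · have hhalf : 1 + (2 * Real.exp 5 ^ 10 * Real.exp (10 - Real.log D₁ / Real.log z₁) +
        (2 + 2 * (2 * Real.exp 5 ^ 10 * Real.exp (10 - Real.log D₁ / Real.log z₁))) *
          ((lam ^ (2 * rr + 1))⁻¹ * Real.exp (lam * Real.log (Real.exp 5 * (Real.log z / Real.log z₁))))) =
        1 + sieveErr z₁ z D₁ lam rr / 2 := by
      unfold sieveErr; ring
    rw [hhalf]
    change (Nat.totient k : ℝ) / k * M * (1 + sieveErr z₁ z D₁ lam rr / 2) +
        2 * (σ 0 k : ℝ) * sieveMass z₁ z D₁ rr ≤ _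
    have hF0 : 0 ≤ 1 + sieveErr z₁ z D₁ lam rr / 2 := by positivity
    have h1 : (Nat.totient k : ℝ) / k * M * (1 + sieveErr z₁ z D₁ lam rr / 2) ≤
        M * (1 + sieveErr z₁ z D₁ lam rr / 2) * (σ 0 k : ℝ) := by
      calc (Nat.totient k : ℝ) / k * M * (1 + sieveErr z₁ z D₁ lam rr / 2)
          ≤ 1 * M * (1 + sieveErr z₁ z D₁ lam rr / 2) := by gcongr
        _ = M * (1 + sieveErr z₁ z D₁ lam rr / 2) * 1 := by ring
        _ ≤ M * (1 + sieveErr z₁ z D₁ lam rr / 2) * (σ 0 k : ℝ) :=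
            mul_le_mul_of_nonneg_left hτ (mul_nonneg hM hF0)
    nlinarith

/-- **THE TWO-VARIABLE SIEVE INEQUALITY** (the extension `Δ → Δ*` of BFI §14 p. 246, "as in
Section 12, using Lemma 4", with both `m` and `n` sifted): for the two-range weights with
`2 ≤ z₁ ≤ z`, level `D₁ > 1`, `10 log z₁ ≤ log D₁`, `λ > 0`; an `l`-weight with `0 ≤ ωl ≤ T` on
`l ≤ L` and `∑_{l ≤ L, (l,r)=1} ωl ≤ Λ`; `M, N ≥ 0`; and a bound `B_d` for all the SMOOTH pieces
`deltaW(M/d, N/e, L e d; 1, 1, 1)` with `0 < d, e < D₁ z^{2r+1}`: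
`deltaW(M, N, L; ωl, 1_rough, 1_rough) ≤ 9 T N_w² B_d + Λ S · Rem`,
`Rem = N(ME₀ + 4N_w) + 2(M(1+E₀/2) + 2N_w)(NE₀ + 4N_w) + (ME₀ + 4N_w)(NE₀ + 4N_w)`,
`S = ∑_{r ≤ R, q ≤ Q} τ(qr)²/φ(qr)` (`E₀ = sieveErr`, `N_w = sieveMass`).
[cite: BombieriFriedlanderIwaniecActa1986, §12 p. 238; §14 p. 246] -/
theorem deltaW_rough_rough_le {z₁ z D₁ lam : ℝ} {rr : ℕ} (hz₁ : 2 ≤ z₁) (hz : z₁ ≤ z) (hD1 : 1 < D₁)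
    (hzD : 10 * Real.log z₁ ≤ Real.log D₁) (hlam : 0 < lam) {ωl : ℕ → ℝ} {T Λ L : ℝ} (hT : 0 ≤ T)
    (hΛ0 : 0 ≤ Λ) (hωl0 : ∀ l, 0 ≤ ωl l) (hωl1 : ∀ l ∈ Icc 1 ⌊L⌋₊, ωl l ≤ T)
    (hΛ : ∀ r : ℕ, ∑ l ∈ (Icc 1 ⌊L⌋₊).filter (fun l : ℕ => l.Coprime r), ωl l ≤ Λ)
    (a : ℤ) {M N : ℝ} (hM : 0 ≤ M) (hN : 0 ≤ N) (Q R : ℝ) {Bd : ℝ} (hBd0 : 0 ≤ Bd)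
    (hBd : ∀ d e : ℕ, 0 < d → (d : ℝ) < D₁ * z ^ (2 * rr + 1) → 0 < e → (e : ℝ) < D₁ * z ^ (2 * rr + 1) →
      deltaW a (M / d) (N / e) (L * e * d) Q R (fun _ => 1) (fun _ => 1) (fun _ => 1) ≤ Bd) :
    deltaW a M N L Q R ωl (roughIndicator z) (roughIndicator z) ≤
      9 * T * sieveMass z₁ z D₁ rr ^ 2 * Bd +
      Λ * (N * (M * sieveErr z₁ z D₁ lam rr + 4 * sieveMass z₁ z D₁ rr) +
        2 * ((M * (1 + sieveErr z₁ z D₁ lam rr / 2) + 2 * sieveMass z₁ z D₁ rr) *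
          (N * sieveErr z₁ z D₁ lam rr + 4 * sieveMass z₁ z D₁ rr)) +
        (M * sieveErr z₁ z D₁ lam rr + 4 * sieveMass z₁ z D₁ rr) *
          (N * sieveErr z₁ z D₁ lam rr + 4 * sieveMass z₁ z D₁ rr)) *
        ∑ r ∈ Icc 1 ⌊R⌋₊, ∑ q ∈ Icc 1 ⌊Q⌋₊, (σ 0 (q * r) : ℝ) ^ 2 / (Nat.totient (q * r) : ℝ) := by
  -- notation
  set ρ : ℕ → ℝ := roughIndicator z with hρ
  set U : ℕ → ℝ := sieveU z₁ z D₁ rr with hU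
  set UL : ℕ → ℝ := fun m => sieveU z₁ z D₁ rr m - sieveL z₁ z D₁ rr m with hUL
  set E₀ : ℝ := sieveErr z₁ z D₁ lam rr with hE₀
  set Nw : ℝ := sieveMass z₁ z D₁ rr with hNw
  set S : ℝ := ∑ r ∈ Icc 1 ⌊R⌋₊, ∑ q ∈ Icc 1 ⌊Q⌋₊, (σ 0 (q * r) : ℝ) ^ 2 / (Nat.totient (q * r) : ℝ) with hS
  have hz1 : 1 ≤ z := by linarith
  have hρ0 : ∀ n, 0 ≤ ρ n := roughIndicator_nonneg z
  have hρ1 : ∀ n, ρ n ≤ 1 := fun n => by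
    rw [hρ]; unfold roughIndicator; split_ifs <;> norm_num
  have hU0 : ∀ {X : ℝ}, ∀ n ∈ Icc 1 ⌊X⌋₊, 0 ≤ U n := fun n hn => by
    rw [Finset.mem_Icc] at hn; exact sieveU_nonneg hz D₁ rr (by omega)
  have hUL0 : ∀ {X : ℝ}, ∀ n ∈ Icc 1 ⌊X⌋₊, 0 ≤ UL n := fun n hn => by
    rw [Finset.mem_Icc] at hn; exact sieveU_sub_sieveL_nonneg hz D₁ rr (by omega)
  have hE0 : 0 ≤ E₀ := sieveErr_nonneg z₁ z D₁ hlam rr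
  have hNw0 : 0 ≤ Nw := sieveMass_nonneg z₁ z (by linarith) rr
  have hS0 : 0 ≤ S := Finset.sum_nonneg fun _ _ => Finset.sum_nonneg fun _ _ => by positivity
  -- the smooth pieces after two expansions: first in the variable at scale `X` (weight `V`), bound `Bd · Nw`
  have hinner : ∀ e : ℕ, 0 < e → (e : ℝ) < D₁ * z ^ (2 * rr + 1) →
      deltaW a (N / e) M (L * e) Q R (fun _ => 1) (fun _ => 1) U ≤ 1 * (Bd * Nw) ∧
      deltaW a (N / e) M (L * e) Q R (fun _ => 1) (fun _ => 1) UL ≤ 1 * (Bd * Nw) := by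
    intro e he helt
    constructor
    · rw [deltaW_comm]
      exact deltaW_sieveU_le hD1 hzD hz1 zero_le_one (fun _ => zero_le_one) (fun _ _ => le_rfl) a hM
        (N / e) Q R (fun _ => 1) hBd0 fun d hd hdlt => hBd d e hd hdlt he helt
    · rw [deltaW_comm]
      exact deltaW_sieveUL_le hD1 hzD hz1 zero_le_one (fun _ => zero_le_one) (fun _ _ => le_rfl) a hM
        (N / e) Q R (fun _ => 1) hBd0 fun d hd hdlt => hBd d e hd hdlt he helt
  have hBdNw : 0 ≤ Bd * Nw := mul_nonneg hBd0 hNw0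
  -- the four doubly expanded terms, each `≤ T · Bd · Nw²`
  have hUU : deltaW a N M L Q R ωl U U ≤ T * (Bd * Nw * Nw) :=
    deltaW_sieveU_le hD1 hzD hz1 hT hωl0 hωl1 a hN M Q R U hBdNw fun e he helt =>
      (one_mul (Bd * Nw)) ▸ (hinner e he helt).1
  have hULU : deltaW a N M L Q R ωl UL U ≤ T * (Bd * Nw * Nw) :=
    deltaW_sieveUL_le hD1 hzD hz1 hT hωl0 hωl1 a hN M Q R U hBdNw fun e he helt =>
      (one_mul (Bd * Nw)) ▸ (hinner e he helt).1
  have hUUL : deltaW a N M L Q R ωl U UL ≤ T * (Bd * Nw * Nw) :=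
    deltaW_sieveU_le hD1 hzD hz1 hT hωl0 hωl1 a hN M Q R UL hBdNw fun e he helt =>
      (one_mul (Bd * Nw)) ▸ (hinner e he helt).2
  have hULUL : deltaW a N M L Q R ωl UL UL ≤ T * (Bd * Nw * Nw) :=
    deltaW_sieveUL_le hD1 hzD hz1 hT hωl0 hωl1 a hN M Q R UL hBdNw fun e he helt =>
      (one_mul (Bd * Nw)) ▸ (hinner e he helt).2
  -- the three sandwiches
  have h1 := deltaW_rough_le_sandwich hz D₁ rr hωl0 (fun n _ => hρ0 n) a M L Q R (ωn := ρ) (N := N)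
  have h2 := deltaW_rough_le_sandwich hz D₁ rr hωl0 (hU0 (X := M)) a N L Q R (ωn := U) (N := M)
  have h3 := deltaW_rough_le_sandwich hz D₁ rr hωl0 (hUL0 (X := M)) a N L Q R (ωn := UL) (N := M)
  -- the three remainders
  have hA_ρ : ∀ k : ℕ, k ≠ 0 → 0 ≤ ∑ n ∈ Icc 1 ⌊N⌋₊, ρ n * (if n.Coprime k then (1 : ℝ) else 0) ∧
      ∑ n ∈ Icc 1 ⌊N⌋₊, ρ n * (if n.Coprime k then (1 : ℝ) else 0) ≤ N * (σ 0 k : ℝ) :=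
    fun k hk => sum_weight_coprime_bounds hρ0 hρ1 hN hk
  have hB_M : ∀ k : ℕ, k ≠ 0 → _ ∧ _ := fun k hk =>
    (sum_sieve_coprime_tau_bounds (rr := rr) hz₁ hz hD1 hzD hM hlam hk).1
  have hA_M : ∀ k : ℕ, k ≠ 0 → _ ∧ _ := fun k hk =>
    (sum_sieve_coprime_tau_bounds (rr := rr) hz₁ hz hD1 hzD hM hlam hk).2
  have hB_N : ∀ k : ℕ, k ≠ 0 → _ ∧ _ := fun k hk =>
    (sum_sieve_coprime_tau_bounds (rr := rr) hz₁ hz hD1 hzD hN hlam hk).1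
  have hRem1 := remainder_le (a := a) (Q := Q) (R := R) hωl0 hΛ0 hΛ hN (by positivity) hA_ρ hB_M
  have hRem2 := remainder_le (a := a) (Q := Q) (R := R) hωl0 hΛ0 hΛ (by positivity) (by positivity) hA_M hB_N
  have hRem3 := remainder_le (a := a) (Q := Q) (R := R) hωl0 hΛ0 hΛ (by positivity) (by positivity) hB_M hB_N
  -- assemble
  have hPU : deltaW a M N L Q R ωl U ρ ≤ 3 * (T * (Bd * Nw * Nw)) +
      Λ * (M * (1 + E₀ / 2) + 2 * Nw) * (N * E₀ + 4 * Nw) * S := by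
    rw [deltaW_comm]
    linarith [h2, hUU, hULU, hRem2]
  have hPUL : deltaW a M N L Q R ωl UL ρ ≤ 3 * (T * (Bd * Nw * Nw)) +
      Λ * (M * E₀ + 4 * Nw) * (N * E₀ + 4 * Nw) * S := by
    rw [deltaW_comm]
    linarith [h3, hUUL, hULUL, hRem3]
  have hmain : deltaW a M N L Q R ωl ρ ρ ≤ 2 * (3 * (T * (Bd * Nw * Nw)) +
      Λ * (M * (1 + E₀ / 2) + 2 * Nw) * (N * E₀ + 4 * Nw) * S) +
      (3 * (T * (Bd * Nw * Nw)) + Λ * (M * E₀ + 4 * Nw) * (N * E₀ + 4 * Nw) * S) +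
      Λ * N * (M * E₀ + 4 * Nw) * S := by
    linarith [h1, hPU, hPUL, hRem1]
  refine hmain.trans (le_of_eq ?_)
  ring


end BFI

end Literature.NumberTheory.Sieve
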